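/-
Copyright: lit-balaban Phase-2 proof seat p27 (gen 34).  Statement-level skeleton of a published paper; no proof claims beyond what the
kernel checks below.
-/
import Literature.MathematicalPhysics.QuantumFieldTheory.BalabanImbrieJaffe1984to88.BIJ88FreeNeumannResolventBox
import Literature.MathematicalPhysics.QuantumFieldTheory.BalabanImbrieJaffe1984to88.BIJ88NeumannPropagatorSmallFieldRegion
import Literature.MathematicalPhysics.QuantumFieldTheory.BalabanImbrieJaffe1984to88.BIJ88NeumannPropagatorFlatDecayCube
import Literature.MathematicalPhysics.QuantumFieldTheory.BalabanImbrieJaffe1984to88.BIJ85CovariantHiggsDictionary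
import Literature.MathematicalPhysics.QuantumFieldTheory.BalabanImbrieJaffe1984to88.BIJ88DeltaLoc234Torus
import Literature.MathematicalPhysics.QuantumFieldTheory.BalabanImbrieJaffe1984to88.BIJ88NeumannPropagatorSmallPlaquetteRegion

/-!
# [BalabanImbrieJaffe1988] (2.30) p. 263 / [BalabanImbrieJaffe1985] §7.3 p. 326 / [6] (1.10) p. 573 — **THE `k`-UNIFORM SUP-NORM
# (OPERATOR-FORM) DECAY OF THE CUBE NEUMANN PROPAGATORS `G_k(□,u)` AT NON-FLAT SMALL FIELDS:
# `|(G_k(□,u)f)(x)| ≤ c₀(L^kε)²e^{−t₀dist_∞(x, supp f)/L^k}‖f‖_∞`** — p31's displayed hypothesis (H1.10) of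
# `BIJ88DeltaLocClose235General` at `X = □_α` and non-flat `u`, by Kato's inequality on the cube, the comparison principle for the free
# massive Neumann resolvent of [6]'s box and its tilted row bound (kernel file `BIJ88FreeNeumannResolventBox`), and p34's weighted `ℓ²`
# (Agmon) bound on the region; file 2 of 2; §5: the (H1.10) binder verbatim and the bound in every gauge;
# v1.1 (§6): THE SAME BOUND UNDER THE PRINTED HYPOTHESIS (7.3.1) — small plaquette variables on the fine torus, NO gauge condition —
# by p30's centred axial gauge and p34's locality `gBox_congr` (the route of p34's `BIJ88NeumannPropagatorSmallPlaquetteRegion`);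
# v1.2 (§7): THE SAME WITH A THRESHOLD DEPENDING ON `(d, L^k)` ONLY — uniform in the cube and the volume — by the BLOCKWISE centred gauge
# (the engine's hypotheses are block-local; p34's locality `holCK_congr` of the composite transports);
# v1.3 (doc-only, referee ref-5 D-g64-1): the printed (7.3.1) quoted verbatim in HONEST SCOPE (iv) — it constrains the UNIT-lattice
# plaquettes of `v`, the files' `θ` the FINE plaquettes of `u`; declarations unchanged

T. Bałaban, J. Imbrie, A. Jaffe, *Effective action and cluster properties of the abelian Higgs model*, Commun. Math. Phys. **114** (1988)
257–315 [BalabanImbrieJaffe1988], Sect. 2 p. 262–263 [PDF 6–7], (2.27)/(2.30); [I] = T. Bałaban, J. Imbrie, A. Jaffe, *Renormalization of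
the Higgs model: minimizers, propagators and the stability of mean field theory*, Commun. Math. Phys. **97** (1985) 299–329
[BalabanImbrieJaffe1985], (2.6) p. 303, (6.3.2) p. 320, §7.3 p. 326 [PDF 28]; [6] = [7] of [I] = T. Bałaban, *Regularity and decay of lattice
Green's functions*, Commun. Math. Phys. **89** (1983) 571–597 [Balaban1983RegularityDecay], (1.10) p. 573, (2.44) p. 584.

statement-level skeleton of published theorems with citation tags; proofs where landed; nothing here is a claim about the Yang–Mills mass gap

PDF held: `paper:balaban1988-cmp114-bij-abelian-higgs-effective-action` (journal page = PDF page + 256), p. 262–263 [PDF 6–7];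
`paper:balaban1985-cmp97-bij-higgs-minimizers` (journal page = PDF page + 298), p. 303 [PDF 5], p. 320 [PDF 22], p. 326 [PDF 28]; [6] (1.10)
as transcribed in the tree's `Balaban1983to89.B4Thm110ZeroTorus`.

CITATION HEADER (lean-in-tree rule).  Part of the lit-balaban TYPED SKELETON (HOME `run/shared/lean/pub/lit-balaban/`), PHASE-2 proof seat
p27 gen 34 (unit `lit-balaban-p27-g34`; TAKING line HOME/STATUS.md 2026-08-23T00:16Z; free-target protocol G.5-34(d) — SOURCE: the
successor item declared by p34 gen 16 in the HONEST SCOPE (i) of `BIJ88NeumannPropagatorSmallFieldRegion` (p344577): *"KERNEL (and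
ℓ²-source) form only: the printed ‖f‖_∞ right-hand side of (1.10)/(2.30) follows with the row sum c₀(L^kε)²Σ_y e^{−t₀|x−y|/L^k} ≍
c₀(L^kε)²L^{kd}, i.e. NOT k-uniformly; the k-uniform ‖f‖_∞ member needs the free tilted row bound of p27's route … on the region, not done
here (successor-sized)"*; no objection in the window: r15 g13 00:17:52Z, r18 g23 00:37:49Z (*"exactly the member ROWS-C2 v2.48 names as
missing in cell C2.Eq2.30"*), p31 g20 00:40:20Z (binder shape, §5)).  WHAT IS REPRODUCED: located members of row **C2.Eq2.30**
(`HOME/lit-balaban-r18/ROWS-C2.md`, owner r18; the display's decl of record stays r18's one-letter shape and p02's/p31's hence-steps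
`BIJ88OpDecay230Proof` / `BIJ88DeltaLocClose235General.opDecay230_of_input`, which take the present bound as the displayed hypothesis
(H1.10) per cube) and of row **C1.Eq7.3.1-7.3.2** (`HOME/lit-balaban-r15/ROWS-C1.md`, owner r15: the p. 326 sentence on the propagators
arising from `Δ_k(u_k)`), for p31 gen 15's CONSTRUCTED cube propagators of record `gBox … (cubeT …)` AT NON-FLAT SMALL FIELDS, in the
`k`-UNIFORM OPERATOR (`‖f‖_∞`) FORM.  No head changes.  Kind «model-level theorems only» (no new definition, no `Prop`-valued fact).

THE PRINTED TEXT (verbatim).  C2 p. 262–263 [PDF 6–7]: *"In the scalar field sector, we have the η-lattice propagators G_k(Ω,u) defined on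
subsets Ω ⊂ T_η with Neumann boundary conditions. To localize the dependence on u, we interpolate in a smooth fashion between operators with
Neumann boundary conditions on small cubes. … a straightforward application of the random walk expansion of [6] shows that
|(G_{k,loc}(u)f)(x)| ≦ ce^{−c dist(suppt f,x)}‖f‖_∞, (2.30)"*.  [I] p. 326 [PDF 28]: *"These inequalities can be proved by an extension of the
proofs of [7]. The propagators arising from Δ_k(u_k), under the restriction (7.3.1) on the gauge field, also satisfy the regularity and decay
estimates of [7]."*  [6] (1.10) p. 573 (as transcribed in `B4Thm110ZeroTorus`): *"|(D^η_{A,μ}G_k(Ω, A)f)(x)|, |(G_k(Ω, A)f)(x)| ≤ c₀exp(−δ₀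
dist(x, supp f))‖f‖_∞ (1.10)"* — the VALUE member, here for `Ω = □` a cube.

THE OBJECTS (all p31/p34/pv07/b04, with bodies; nothing defined here).  The cube `□ = cubeT hPd (L^k) c (L^k·M)` of the `ε`-torus (p31
`BIJ88NeumannPropagatorFlatDecayCube`: the image of [6]'s box `Π_i[0, L^kM_i)` under the chart `cubePt`, a union of `k`-blocks, shorter than the
torus in every direction); its Neumann propagator at the field `u`, `G_k(□,u) = gBox (α_k(a)L^{kd}) ε⁻¹ u k □` (p31
`BIJ88NeumannPropagator227Torus.gBox`: the inverse on `ℓ²(□)` of `N = (χ_□D_u)ᴴ(χ_□D_u) + α_kL^{kd}(Q_k(u)|_□)ᴴ(Q_k(u)|_□)`, extended by `0`;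
`α_k(a) = a_k(L^kε)^{−2}` b01's coefficient, `Q_k(u)` the covariant block average (2.6) with entries `L^{−kd}u(Γ^{(k)}_{yx})`); p34's
small-field hypotheses on `□` (bondwise `|u(b) − 1| ≤ T` on the intra-block bonds of `□^★`, `|u(Γ^{(k)}_y) − 1| ≤ δ` on `□`, and
`2(L^k−1)L^k·d·T² + 2δ² ≤ 1/2`); the free massive Neumann resolvent `R_□ = (boxOpR (L^k) 0 1 M)⁻¹` of the kernel file.

THE MECHANISM (p27 gen 32's whole-torus route `BIJ85ScalarPropagatorSupDecay.decay110_smallField`, ported to the cube; DIVERGENCE OF METHOD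
from the printed random-walk expansion disclosed).  Fix `x ∈ □` (off `□` the row vanishes, p34 `gBox_mulVec_eq_zero_of_not_mem`), put
`φ = G_k(□,u)f`, `v = |φ|`.  (§1, STEP 1–2) On `□`, `Nφ = f`, i.e. `(χD_u)ᴴ(χD_u)φ = f − α_kL^{kd}(Q_k|_□)ᴴ(Q_k|_□)φ` (p34
`nOp_mulVec_gBox_mulVec`); KATO'S INEQUALITY for the Neumann-cut covariant Laplacian (`kato_region`, phase method with r01's bond expansion
`gram_dN_mulVec_apply_region`; `|u(b)| = 1`) and the domination of the covariant block term by pv07's flat block average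
(`norm_gram_qMatK_region_mulVec_le`, `|u(Γ)| = 1`) give, at the points of `□`, `ε^{−2}Σ_{b∈□^★, b∋y}(v(y) − v(y′)) + m₀v(y) ≤ g(y)`,
`g = |f| + α_kQ_k^*Q_kv + m₀v`, `m₀ = (L^kε)^{−2}` (one unit of mass on the block scale, added on both sides).  (§3, STEP 3–4) Read in [6]'s box
through the chart (`lapPart_cubePt`: the in-cube bond sum at `cubePt z` is the box-neighbour sum at `z`), this says `H_□V ≤ (L^kε)²·g∘cubePt`
for `V = v∘cubePt` and `H_□ = L^{2k}(−Δ^N_□) + 1`; the COMPARISON PRINCIPLE of the kernel file (`le_boxR_mulVec`) gives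
`v(x) ≤ (L^kε)²Σ_z R_□(z_x,z)g(cubePt z)`.  (STEP 5) Cauchy–Schwarz with the box weight `w = e^{t|z_x−·|_∞/L^k}`: `v(x)² ≤ (L^kε)⁴·W·Σ_z
(w(z)^{−1}g(cubePt z))²`, `W = Σ_z(w(z)R_□(z_x,z))² ≤ C₀L^{−kD}` THE TILTED ROW BOUND (`tilted_row_boxR_sq_le`, `D = d+1 ≤ 3`); the
second factor is read back on the torus with the weight `ω = e^{−t|x−·|_∞/L^k}` (`supDist_cubePt_le`: the torus sup-distance of chart points is
at most the box distance; `sum_box_le_sum_torus`).  (STEP 6) `Σ(ωg)² ≤ 3(B + α_k²A_Q + m₀²A)` with `B = Σ(ω|f|)² ≤ F²·K_t·L^{kD}` (radial sum,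
p27 `sum_exp_neg_supDist_scale_le`), `A_Q = Σ(ωQ^*Qv)² ≤ e^{2t}A` (p27 `tilted_sq_QQ_le`), and `A = Σ(ωv)² ≤ (2(L^kε)²/μ₁)²B` by p34's
WEIGHTED `ℓ²` (AGMON) BOUND ON THE REGION `agmon_weighted_region` with the gap `agmon_gap_region` (`μ₁ = min(1/4, a/8)`, weight
oscillations `weight_bond_osc_sq`/`weight_block_osc_sq`, `t ≤ μ₁/((2d+a)e)`).  (STEP 7) The `L^{kD}` of the radial sum cancels against the
`L^{−kD}` of the tilted row: `v(x) ≤ √(C₀C₂K_t)·(L^kε)²·e^{−(t/2)D₀/L^k}·F` whenever `f` vanishes on `{|x−·|_∞ < D₀}` (`assembly_arith_cube`,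
gen 32's bookkeeping).

WHAT IS PROVED (theorems only; 0 `sorry`; standard axioms; no new definition, no `Prop`-valued fact).
* §1 **`kato_region`** — Kato's inequality for `(χ_ΩD_u)ᴴ(χ_ΩD_u) + m` on any region `Ω`, pointwise, every `U(1)` field.
* §2 **`norm_gram_qMatK_region_mulVec_le`** — `|((Q_k|_Ω)ᴴ(Q_k|_Ω)φ)(x)| ≤ L^{−kd}(Q_k^*Q_k|φ|)(x)`.
* §3 `sum_boxNbrs_eq_steps`, **`lapPart_cubePt`** (the Neumann part in the chart), `supDist_cubePt_le`, `sum_box_le_sum_torus`.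
* §4 **`decay110_smallField_cube`** — for `D = d + 1 ≤ 3`, `L = ℓ + 1 ≥ 2`, `a > 0` there are `t₀, c₀ > 0` (from `(d, ℓ, a)` only) such
  that for every parameter set `P` with these `d, L`, every scale `1 ≤ k ≤ m + K`, every cube `□ = cubeT hPd (L^k) c (L^kM)` (`M_i ≥ 1`,
  `c_iL^k + L^kM_i ≤ |T|` and `L^kM_i < |T|` per direction), every `U(1)` field `u` with p34's small-field hypotheses `(T, δ)` on `□`, every
  `x`, every `f` with `‖f‖_∞ ≤ F` vanishing on `{z : |x − z|_∞ < D₀}`: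
  `‖(G_k(□,u)f)(x)‖ ≤ c₀(L^kε)²e^{−t₀D₀/L^k}F`.
* §5 **`decay110_smallField_cube_input`** — the same in p31's (H1.10) binder shape (`B5Ineq137Torus.T`, `(L^kε)²·(c₀e^{−δ₀(L^k)^{−1}D}F)`);
  **`decay110_smallField_cube_gaugeAct`** — the same bound for `G_k(□,u^h)`, every gauge transformation `h` (p31 `gBox_gaugeAct`).
* §6 (v1.1) **`decay110_smallPlaquette_cube`** — the (H1.10)-shaped bound for `G_k(□,u)` itself under `|u(∂p) − 1| ≤ θ` for all plaquettes
  of the fine torus, the cube inside the ball of sup-radius `R ≥ L^kM_i` around its corner, `2R + 4 < |T|`, `T ≥ dRθ` (`d = P.d − 1`) with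
  `2(L^k−1)L^k(d+1)T² + 2((d+1)(L^k−1)T)² ≤ 1/2` — p34's `decay_kernel_smallPlaquette_cubeT` data; NO gauge condition on `u`.
* §7 (v1.2) **`decay110_smallPlaquette_cube_uniform`** — the same with the ball radius replaced by the BLOCK size: `2(L^k − 1) + 4 < |T|`,
  `T ≥ d(L^k − 1)θ`, `2(L^k−1)L^k(d+1)T² + 2((d+1)(L^k−1)T)² ≤ 1/2` (met when `8(d+1)⁴L^{4k}θ² ≤ 1/2`, the order `L^{−2k}` of gen 32's
  whole-torus threshold `2d³(L^{2k}θ)² ≤ 1`), for EVERY fitting no-wrap cube — uniform in `M`, `c` and the volume.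

HONEST SCOPE.  (i) The VALUE member of (1.10)/(2.30) only; the covariant-derivative member `|(D_uG_k(□,u)f)(b)|` in operator form and the
Hölder member (1.11) are not treated here (p34's §7–§8 give the derivative member in kernel form).  (ii) Cubes only (`X = □_α` of (2.27)):
chart images of [6]'s boxes, no wrap-around (`L^kM_i < |T|`), at least one block per direction; a general outer block union `Ω` and the
closeness member (H1.12) at non-flat `u` remain displayed hypotheses of p31's file.  (iii) `D = d + 1 ≤ 3` (the tilted row bound of the
kernel file); `1 ≤ k ≤ m + K`.  (iv) Small fields: in §4 in p34's BONDWISE sense inside `□` (`T, δ` with `2(L^k−1)L^kdT² + 2δ² ≤ 1/2`) for the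
field itself, in §5 for any gauge-equivalent field, and in §6 (v1.1) under the PLAQUETTE smallness `|u(∂p) − 1| ≤ θ` of the whole fine
torus with the displayed threshold `dRθ ≤ T`, `2(L^k−1)L^k(d+1)T² + 2((d+1)(L^k−1)T)² ≤ 1/2` — a threshold on `θ` that shrinks like
`1/(R·L^{2k})` with the ball radius `R ≥ L^kM_i` (same data as p34's `decay_kernel_smallPlaquette_cubeT`) — and in §7 (v1.2) with `R`
replaced by the block size `L^k − 1`, i.e. a threshold `θ ≲ 1/((d+1)²L^{2k})` depending on `(d, L^k)` only.  THE PRINTED (7.3.1) IS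
NOT THIS HYPOTHESIS (v1.3, referee ref-5 D-g64-1): [I] p. 326 [PDF 28, text layer L13–14] prints *"let us assume that for the unit lattice
field v, |v(∂p) − 1| ≦ e_kμ(e_k), (7.3.1) where μ(e_k) = (1 + ln e_k^{−1})^p"* — a smallness condition on the plaquette variables of the
UNIT-LATTICE (`T^{(k)}_1`-scale) field `v`, whereas §6/§7 (and p34's region files) assume `|u(∂p) − 1| ≤ θ` for the FINE-torus plaquettes of
the background `u` itself; a unit-lattice plaquette is tiled by `L^{2k}` fine plaquettes, so the thresholds `θ ≲ L^{−2k}` displayed here are the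
consistent block-scale reading of a unit-scale smallness, but NOTHING beyond the displayed inequalities is asserted about the passage from the
printed (7.3.1) on `v` to the fine-plaquette hypothesis on `u` (that passage, for the actual backgrounds `u_k` of the induction, is p33's
`BIJ85Claim73PropagatorDecay` lane); «(7.3.1)» in the titles of §6/§7 means «(7.3.1)-TYPE plaquette smallness, stated on the fine plaquettes
of u».  (v) Constants existential, explicit in the proof
(`t₀ = t/2`, `t = min(t₁, 1, μ₁/((2D+a)e))`, `c₀ = √(C₀C₂K_t)`), depending on `(d, ℓ, a)` only — uniform in `k`, in the cube, in the
volume and in the field.  (vi) `set_option maxHeartbeats 800000` on §4's theorem (long bookkeeping; no automation beyond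
`linarith`/`nlinarith`/`positivity`/`ring`).  DIVERGENCE OF METHOD as stated (Kato + free Neumann resolvent + multiscale box pieces in place
of [6]'s random walk expansion).  Nothing here is summit progress.  Unit `lit-balaban-p27` (literature-prover-lit-balaban-p27-g34-0), HOME
`run/shared/lean/pub/lit-balaban/`, 2026-08-23; v1.3 DOC-ONLY (literature-prover-lit-balaban-p27-g35-0, 2026-08-23): HONEST SCOPE (iv)
re-worded on referee ref-5's finding D-g64-1, every declaration byte-identical to v1.2 (p349473).
-/

open scoped BigOperators
open Finset Matrix

namespace Literature.MathematicalPhysics.QuantumFieldTheory.BalabanImbrieJaffe1984to88.BIJ88NeumannPropagatorSmallFieldSupDecay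

open scoped ComplexConjugate
open Literature.MathematicalPhysics.QuantumFieldTheory.Balaban1983to89
open LatticeFieldCalculus (supDist)
open BIJ88Sect3Statements (U1 toC cfg starB mem_starB norm_toC)
open BIJ85BlockAveragesTorus BIJ85BlockAveragesTorusK
open BIJ88NeumannNoZeroModesTorus (IsBlockUnion)
open BIJ88NeumannPropagator227Torus (nOp gBox dN qMatK proj nOp_eq qMatK_apply qMatK_mulVec proj_mulVec)
open BIJ88NeumannPropagatorFlatDecayCube (cubePt cubeT cubePt_mem_cubeT mem_cubeT isBlockUnion_cubeT shift_cubePt_mem_iff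
  unshift_cubePt_mem_iff cubePt_add_single cubePt_sub_single T_cubePt_le sum_cubeT)
open BIJ88NeumannPropagatorSmallFieldRegion (agmon_weighted_region agmon_gap_region weight_bond_osc_sq weight_block_osc_sq
  nOp_mulVec_gBox_mulVec gBox_mulVec_eq_zero_of_not_mem)
open BIJ85CovariantHiggsDictionary (gram_dN_mulVec_apply_region)
open BIJ85FreeResolventTorus (towerQQ_mulVec_apply tilted_sq_QQ_le weight_block_osc)
open BIJ85FreeResolventTiltedRow (sum_exp_neg_supDist_scale_le)
open B4ContourShift (supNorm supNorm_nonneg)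
open B4Reflection242 (boxDom mem_boxDom nbrs)
open B4Green242Bridge (boxNbrs)
open B4BoxCov237 (boxOpR)
open BIJ88FreeNeumannResolventBox (boxH_mulVec le_boxR_mulVec tilted_row_boxR_sq_le)

noncomputable section

variable {P : Params}

/-! ## §1 Kato's inequality for the Neumann-cut covariant Laplacian `(χ_ΩD_u)ᴴ(χ_ΩD_u)` of a region (pointwise, gauge-blind) -/

/-- kernel: a unit phase aligned with `φ(x)` — `σ = φ(x)/|φ(x)|` (`0` if `φ(x) = 0`): `|σ| ≤ 1`, `Re(σ̄φ(x)) = |φ(x)|`. [folklore] -/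
private theorem phase_facts (w : ℂ) :
    ∃ σ : ℂ, ‖σ‖ ≤ 1 ∧ (conj σ * w).re = ‖w‖ := by
  by_cases hw : w = 0
  · exact ⟨0, by simp, by simp [hw]⟩
  · have hn : (‖w‖ : ℂ) ≠ 0 := by exact_mod_cast (norm_ne_zero_iff.2 hw)
    refine ⟨w / (‖w‖ : ℂ), ?_, ?_⟩
    · rw [norm_div, Complex.norm_real, Real.norm_of_nonneg (norm_nonneg _), div_self (norm_ne_zero_iff.2 hw)]
    · rw [map_div₀, Complex.conj_ofReal, div_mul_eq_mul_div, Complex.conj_mul', ← Complex.ofReal_pow, ← Complex.ofReal_div,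
        Complex.ofReal_re, sq, mul_div_assoc, div_self (norm_ne_zero_iff.2 hw), mul_one]

/-- kernel: against a phase of modulus `≤ 1`, a unimodular multiple of `w` has real part `≤ |w|`. [folklore] -/
private theorem re_phase_mul_le {σ a w : ℂ} (hσ : ‖σ‖ ≤ 1) (ha : ‖a‖ = 1) : (conj σ * (a * w)).re ≤ ‖w‖ := by
  refine (Complex.re_le_norm _).trans ?_
  rw [norm_mul, norm_mul, RCLike.norm_conj, ha, one_mul]
  exact mul_le_of_le_one_left (norm_nonneg _) hσ

/-- **KATO'S INEQUALITY (diamagnetic domination) FOR THE NEUMANN-CUT COVARIANT LAPLACIAN OF A REGION, pointwise**: for `m ≥ 0`, every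
`U(1)` field, every region `Ω` and every complex field `φ`,
`c²Σ_μ([⟨x,x+e_μ⟩ ⊂ Ω](|φ(x)| − |φ(x+e_μ)|) + [⟨x−e_μ,x⟩ ⊂ Ω](|φ(x)| − |φ(x−e_μ)|)) + m|φ(x)| ≤ |(((χ_ΩD_u)ᴴ(χ_ΩD_u) + m)φ)(x)|` — the free
massive NEUMANN Laplacian of `|φ|` on `Ω` is dominated entrywise by the covariant one (`|u_b| = 1`; gauge-blind; test against the phase of
`φ(x)`). p. 326: *"estimates for G_k(Λ₃,u) … by an extension of the proofs of [7]"* — here the sup-norm step is Kato's inequality, as in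
p27's whole-torus file. [cite: BalabanImbrieJaffe1985, (4.6.3) p.313] -/
theorem kato_region (c m : ℝ) (U : GaugeField P 0 U1) (Ω : Finset (Balaban1983to89.Site P 0))
    (φ : Balaban1983to89.Site P 0 → ℂ) (x : Balaban1983to89.Site P 0) :
    c ^ 2 * (∑ μ : Fin P.d, ((if (⟨x, μ⟩ : PBond P 0) ∈ starB Ω then ‖φ x‖ - ‖φ (x.shift μ)‖ else 0) +
        (if (⟨x.unshift μ, μ⟩ : PBond P 0) ∈ starB Ω then ‖φ x‖ - ‖φ (x.unshift μ)‖ else 0))) + m * ‖φ x‖ ≤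
      ‖(((dN c U Ω)ᴴ * dN c U Ω) *ᵥ φ) x + (m : ℂ) * φ x‖ := by
  obtain ⟨σ, hσ1, hσx⟩ := phase_facts (φ x)
  set T : ℂ := (((dN c U Ω)ᴴ * dN c U Ω) *ᵥ φ) x + (m : ℂ) * φ x with hT
  -- the two families of bond terms
  set A : Fin P.d → ℂ := fun μ => if (⟨x, μ⟩ : PBond P 0) ∈ starB Ω then φ x - cfg U ⟨x, μ⟩ * φ (x.shift μ) else 0 with hA
  set B : Fin P.d → ℂ := fun μ =>
    if (⟨x.unshift μ, μ⟩ : PBond P 0) ∈ starB Ω then φ x - conj (cfg U ⟨x.unshift μ, μ⟩) * φ (x.unshift μ) else 0 with hB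
  -- `Re(σ̄T) ≤ |T|`
  have hre : (conj σ * T).re ≤ ‖T‖ := by
    refine (Complex.re_le_norm _).trans ?_
    rw [norm_mul, RCLike.norm_conj]
    exact mul_le_of_le_one_left (norm_nonneg _) hσ1
  -- `Re(σ̄T) = c²Σ_μ(Re(σ̄A_μ) + Re(σ̄B_μ)) + m|φ(x)|`
  have hexp : (conj σ * T).re = c ^ 2 * ∑ μ : Fin P.d, ((conj σ * A μ).re + (conj σ * B μ).re) + m * ‖φ x‖ := by
    have e2 : ∑ μ : Fin P.d, (conj σ * A μ + conj σ * B μ) = conj σ * ∑ μ : Fin P.d, (A μ + B μ) := by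
      rw [mul_sum]; exact sum_congr rfl fun μ _ => by ring
    have e1 : conj σ * T = ((c ^ 2 : ℝ) : ℂ) * ∑ μ : Fin P.d, (conj σ * A μ + conj σ * B μ) + (m : ℂ) * (conj σ * φ x) := by
      calc conj σ * T = conj σ * ((c : ℂ) ^ 2 * ∑ μ : Fin P.d, (A μ + B μ) + (m : ℂ) * φ x) := by
            rw [hT, gram_dN_mulVec_apply_region]
        _ = (c : ℂ) ^ 2 * (conj σ * ∑ μ : Fin P.d, (A μ + B μ)) + (m : ℂ) * (conj σ * φ x) := by ring
        _ = ((c ^ 2 : ℝ) : ℂ) * ∑ μ : Fin P.d, (conj σ * A μ + conj σ * B μ) + (m : ℂ) * (conj σ * φ x) := by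
            rw [e2]; push_cast; ring
    rw [e1, Complex.add_re, Complex.re_ofReal_mul, Complex.re_ofReal_mul, Complex.re_sum, hσx]
    simp only [Complex.add_re]
  -- termwise domination
  have hAμ : ∀ μ : Fin P.d,
      (if (⟨x, μ⟩ : PBond P 0) ∈ starB Ω then ‖φ x‖ - ‖φ (x.shift μ)‖ else 0) ≤ (conj σ * A μ).re := by
    intro μ
    by_cases h : (⟨x, μ⟩ : PBond P 0) ∈ starB Ω
    · simp only [hA, if_pos h, mul_sub, Complex.sub_re, hσx]
      exact sub_le_sub_left (re_phase_mul_le hσ1 (norm_toC (U ⟨x, μ⟩))) _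
    · simp only [hA, if_neg h, mul_zero, Complex.zero_re, le_refl]
  have hBμ : ∀ μ : Fin P.d,
      (if (⟨x.unshift μ, μ⟩ : PBond P 0) ∈ starB Ω then ‖φ x‖ - ‖φ (x.unshift μ)‖ else 0) ≤ (conj σ * B μ).re := by
    intro μ
    by_cases h : (⟨x.unshift μ, μ⟩ : PBond P 0) ∈ starB Ω
    · simp only [hB, if_pos h, mul_sub, Complex.sub_re, hσx]
      refine sub_le_sub_left (re_phase_mul_le hσ1 ?_) _
      rw [RCLike.norm_conj]; exact norm_toC (U ⟨x.unshift μ, μ⟩)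
    · simp only [hB, if_neg h, mul_zero, Complex.zero_re, le_refl]
  calc c ^ 2 * (∑ μ : Fin P.d, ((if (⟨x, μ⟩ : PBond P 0) ∈ starB Ω then ‖φ x‖ - ‖φ (x.shift μ)‖ else 0) +
          (if (⟨x.unshift μ, μ⟩ : PBond P 0) ∈ starB Ω then ‖φ x‖ - ‖φ (x.unshift μ)‖ else 0))) + m * ‖φ x‖
      ≤ c ^ 2 * ∑ μ : Fin P.d, ((conj σ * A μ).re + (conj σ * B μ).re) + m * ‖φ x‖ :=
        add_le_add (mul_le_mul_of_nonneg_left (sum_le_sum fun μ _ => add_le_add (hAμ μ) (hBμ μ)) (sq_nonneg c)) le_rfl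
    _ = (conj σ * T).re := hexp.symm
    _ ≤ ‖T‖ := hre

/-! ## §2 The block term of a region: `|((Q_k(u)|_Ω)ᴴ(Q_k(u)|_Ω)φ)(x)| ≤ L^{−kd}(Q_k^*Q_k|φ|)(x)` (holonomies have modulus one) -/

/-- **THE COVARIANT BLOCK TERM OF A REGION IS DOMINATED BY THE FLAT BLOCK AVERAGE OF `|φ|`**: for every region `Ω` and every `x`,
`|((Q_k(u)|_Ω)ᴴ(Q_k(u)|_Ω)φ)(x)| ≤ L^{−kd}·(Q_k^*Q_k|φ|)(x)`, `Q_k^*Q_k` pv07's flat block-averaging operator (`(Q_k^*Q_ku)(x) =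
L^{−kd}Σ_{x′∈B^k(x)}u(x′)`); the kept rows of `Q_k(u)|_Ω` are those with `B^k(y) ⊆ Ω` and carry the entries `L^{−kd}u(Γ^{(k)}_{yx})` of
(2.6) (`|u(Γ)| = 1`). [cite: BalabanImbrieJaffe1985, (2.6) p.303] -/
theorem norm_gram_qMatK_region_mulVec_le {k : ℕ} (hk : k ≤ P.m + P.K) (U : GaugeField P 0 U1) (Ω : Finset (Balaban1983to89.Site P 0))
    (φ : Balaban1983to89.Site P 0 → ℂ) (x : Balaban1983to89.Site P 0) :
    ‖(((qMatK U k Ω)ᴴ * qMatK U k Ω) *ᵥ φ) x‖ ≤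
      ((P.L : ℝ) ^ (k * P.d))⁻¹ * ((B1RG242Torus.Qks P k * B1RG242Torus.Qk P k) *ᵥ fun z => ‖φ z‖) x := by
  have hk0 : 0 + k ≤ P.m + P.K := by omega
  -- the flat block average of `|φ|` at `x`, nonnegative
  have hS : univ.filter (fun z' : Balaban1983to89.Site P 0 => Balaban1983to89.Site.proj k k z' = Balaban1983to89.Site.proj k k x) =
      blockK k (blkIter k x) := by
    ext z'
    rw [mem_filter, mem_blockK, BIJ88NeumannPropagatorFlatDecay.blkIter_eq_iff_proj_eq hk, B1RG242Torus.lvl_of_le P hk]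
    simp
  have hQQ : ((B1RG242Torus.Qks P k * B1RG242Torus.Qk P k) *ᵥ fun z => ‖φ z‖) x =
      ((P.L : ℝ) ^ (k * P.d))⁻¹ * ∑ z' ∈ blockK k (blkIter k x), ‖φ z'‖ := by
    rw [towerQQ_mulVec_apply hk, hS, inv_pow, ← pow_mul, Nat.mul_comm P.d k]
  have hRHS : 0 ≤ ((P.L : ℝ) ^ (k * P.d))⁻¹ * ((B1RG242Torus.Qks P k * B1RG242Torus.Qk P k) *ᵥ fun z => ‖φ z‖) x := by
    rw [hQQ]; exact mul_nonneg (by positivity) (mul_nonneg (by positivity) (sum_nonneg fun _ _ => norm_nonneg _))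
  rw [← mulVec_mulVec, mulVec, dotProduct, Finset.sum_eq_single (blkIter k x)]
  · by_cases hB : blockK k (blkIter k x) ⊆ Ω
    · rw [conjTranspose_apply, qMatK_apply, if_pos ⟨hB, mem_blockK_blkIter k x⟩, qMatK_mulVec, if_pos hB, qCovK_apply, hQQ]
      have hn : ‖((P.L : ℂ) ^ (k * P.d))⁻¹‖ = ((P.L : ℝ) ^ (k * P.d))⁻¹ := by
        rw [norm_inv, norm_pow, Complex.norm_natCast]
      rw [norm_mul, norm_star, norm_mul, norm_mul, hn, norm_holCK U k x, mul_one]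
      refine mul_le_mul_of_nonneg_left (mul_le_mul_of_nonneg_left ((norm_sum_le _ _).trans (le_of_eq ?_)) (by positivity))
        (by positivity)
      exact sum_congr rfl fun z _ => by rw [norm_mul, norm_holCK U k z, one_mul]
    · rw [conjTranspose_apply, qMatK_apply, if_neg (fun h => hB h.1), star_zero, zero_mul, norm_zero]
      exact hRHS
  · intro y _ hy
    rw [conjTranspose_apply, qMatK_apply, if_neg (fun h => hy (mem_blockK.1 h.2).symm), star_zero, zero_mul]
  · exact fun h => absurd (mem_univ _) h

/-! ## §3 The cube chart: the Neumann Laplacian part of Kato's inequality read in [6]'s box, and the two distance/summation comparisons -/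

section Chart

variable {d : ℕ} (hPd : P.d = d + 1) {n : ℕ} {c N : Fin (d + 1) → ℕ}

/-- kernel: a sum over the directions of the torus is a sum over `Fin (d+1)`. [folklore] -/
private theorem sum_dir (f : Fin (d + 1) → ℝ) : ∑ μ : Fin P.d, f (Fin.cast hPd μ) = ∑ i : Fin (d + 1), f i :=
  Fintype.sum_equiv (finCongr hPd) _ _ fun _ => rfl

/-- kernel (real version of b04's `sum_nbrs`): a sum over the nearest neighbours is the sum over the `2(d+1)` unit steps. [folklore] -/
private theorem sum_nbrs_real (φ : (Fin (d + 1) → ℤ) → ℝ) (z : Fin (d + 1) → ℤ) :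
    ∑ u ∈ nbrs z, φ u = ∑ i, φ (z + Pi.single i 1) + ∑ i, φ (z - Pi.single i 1) := by
  have h := B4Green242Bridge.sum_nbrs (fun u => (φ u : ℂ)) z
  exact_mod_cast h

/-- kernel: **a sum over the box neighbours is the sum over the unit steps that stay in the box**. [cite: Balaban1983RegularityDecay, p.572 (1.3), dictionary] -/
theorem sum_boxNbrs_eq_steps (F : (Fin (d + 1) → ℤ) → ℝ) (z : ↥(boxDom N)) :
    ∑ y ∈ boxNbrs N z, F y.1 =
      ∑ i : Fin (d + 1), ((if z.1 + Pi.single i 1 ∈ boxDom N then F (z.1 + Pi.single i 1) else 0) +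
        (if z.1 - Pi.single i 1 ∈ boxDom N then F (z.1 - Pi.single i 1) else 0)) := by
  classical
  unfold boxNbrs
  rw [sum_filter]
  have h1 : ∑ y : ↥(boxDom N), (if y.1 ∈ nbrs z.1 then F y.1 else 0) = ∑ u ∈ boxDom N, (if u ∈ nbrs z.1 then F u else 0) :=
    Finset.sum_coe_sort (boxDom N) (fun u => if u ∈ nbrs z.1 then F u else 0)
  rw [h1, ← sum_filter, Finset.filter_mem_eq_inter, Finset.inter_comm, ← Finset.filter_mem_eq_inter, sum_filter, sum_nbrs_real,
    ← sum_add_distrib]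

/-- **THE NEUMANN LAPLACIAN PART OF KATO'S INEQUALITY, READ IN THE BOX**: for a cube `□ = c·n + Π_i[0,N_i)` shorter than the torus and a box
point `z`, the direction sum of the in-cube differences of a real function `v` at `x = cubePt z` IS the box-neighbour sum of the
differences of `v ∘ cubePt` — [6] p. 572 *"subsets of a torus T_η which we identify with a rectangular parallelepiped"*.
[cite: Balaban1983RegularityDecay, p.572 (1.3), dictionary] -/
theorem lapPart_cubePt (hN : ∀ i, N i < P.sitesPerDir 0) (v : Balaban1983to89.Site P 0 → ℝ) (y : ↥(boxDom N)) :
    ∑ μ : Fin P.d,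
        ((if (⟨cubePt hPd n c y.1, μ⟩ : PBond P 0) ∈ starB (cubeT hPd n c N) then v (cubePt hPd n c y.1) - v ((cubePt hPd n c y.1).shift μ) else 0) +
          (if (⟨(cubePt hPd n c y.1).unshift μ, μ⟩ : PBond P 0) ∈ starB (cubeT hPd n c N) then
              v (cubePt hPd n c y.1) - v ((cubePt hPd n c y.1).unshift μ) else 0)) =
      ∑ y' ∈ boxNbrs N y, (v (cubePt hPd n c y.1) - v (cubePt hPd n c y'.1)) := by
  obtain ⟨z, hz⟩ := y
  have hx : cubePt hPd n c z ∈ cubeT hPd n c N := cubePt_mem_cubeT hPd hz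
  rw [sum_boxNbrs_eq_steps (N := N) (fun u => v (cubePt hPd n c z) - v (cubePt hPd n c u)) ⟨z, hz⟩]
  refine Fintype.sum_equiv (finCongr hPd) _ _ (fun μ => ?_)
  rw [finCongr_apply]
  have hcc : Fin.cast hPd.symm (Fin.cast hPd μ) = μ := Fin.ext rfl
  have e1 : (cubePt hPd n c z).shift μ = cubePt hPd n c (z + Pi.single (Fin.cast hPd μ) 1) := by
    rw [cubePt_add_single, hcc]
  have e2 : (cubePt hPd n c z).unshift μ = cubePt hPd n c (z - Pi.single (Fin.cast hPd μ) 1) := by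
    rw [cubePt_sub_single, hcc]
  have hs : ((⟨cubePt hPd n c z, μ⟩ : PBond P 0) ∈ starB (cubeT hPd n c N)) ↔ z + Pi.single (Fin.cast hPd μ) 1 ∈ boxDom N := by
    rw [mem_starB, ← shift_cubePt_mem_iff hPd hN hz μ]
    exact ⟨fun h => h.2, fun h => ⟨hx, h⟩⟩
  have hu : ((⟨(cubePt hPd n c z).unshift μ, μ⟩ : PBond P 0) ∈ starB (cubeT hPd n c N)) ↔ z - Pi.single (Fin.cast hPd μ) 1 ∈ boxDom N := by
    rw [mem_starB, ← unshift_cubePt_mem_iff hPd hN hz μ]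
    have ht : (⟨(cubePt hPd n c z).unshift μ, μ⟩ : PBond P 0).tgt = cubePt hPd n c z := B5Display136Torus.shift_unshift _ μ
    rw [ht]
    exact ⟨fun h => h.1, fun h => ⟨h, hx⟩⟩
  simp only [hs, hu]
  simp only [e1, e2]

/-- kernel: **torus sup-distance between chart points is dominated by the box sup-distance** (`T_cubePt_le` read through `T = supDist`).
[cite: Balaban1983RegularityDecay, p.572, dictionary] -/
theorem supDist_cubePt_le (hfit : ∀ i, c i * n + N i ≤ P.sitesPerDir 0) {z y : Fin (d + 1) → ℤ} (hz : z ∈ boxDom N) (hy : y ∈ boxDom N) :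
    (supDist (cubePt hPd n c z) (cubePt hPd n c y) : ℝ) ≤ supNorm (z - y) := by
  rw [← B3Bound323ZeroTorus.T_eq_supDist]
  exact T_cubePt_le hPd hfit hz hy

/-- kernel: **a box sum of a nonnegative torus function read through the chart is at most its torus sum**. [cite: Balaban1983RegularityDecay, p.572, dictionary] -/
theorem sum_box_le_sum_torus (hfit : ∀ i, c i * n + N i ≤ P.sitesPerDir 0) {g : Balaban1983to89.Site P 0 → ℝ} (hg : ∀ x, 0 ≤ g x) :
    ∑ y : ↥(boxDom N), g (cubePt hPd n c y.1) ≤ ∑ x, g x := by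
  rw [Finset.sum_coe_sort (boxDom N) (fun u => g (cubePt hPd n c u)), ← sum_cubeT hPd hfit]
  exact sum_le_univ_sum_of_nonneg hg

end Chart

/-! ## §4 The (1.10)-value member in OPERATOR FORM for the cube propagators `G_k(□,u)` at NON-FLAT small fields, `k`-uniform:
`|(G_k(□,u)f)(x)| ≤ c₀(L^kε)²e^{−t₀·dist_∞(x, supp f)/L^k}‖f‖_∞` -/

section Assembly

/-- kernel (the scalar assembly of §4, p27 gen 32's bookkeeping): from `|φ(x)|² ≤ W·G₂` (Cauchy–Schwarz), the tilted row bound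
`W ≤ C₀(L^kε)⁴L^{−kD}`, the split `G₂ ≤ 3(B + α²A_Q + m²A)`, the block bound `A_Q ≤ e^{2t}A`, the Agmon bound `A ≤ (2(L^kε)²/μ)²B`,
`α(L^kε)² = a_k ≤ a`, `m(L^kε)² = 1` and the support bound `B ≤ F²E²KL^{kD}` to `|φ(x)| ≤ √(C₀C₂K)(L^kε)²EF`. [folklore] -/
private theorem assembly_arith_cube {vx W G₂ A A_Q B C₀ sp N F E K α m aS a μ₀ e₂ eₜ : ℝ}
    (hv2 : vx ^ 2 ≤ W * G₂) (hW : W ≤ C₀ * (sp ^ 4 / N)) (hN : 0 < N) (hC₀ : 0 ≤ C₀)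
    (hG₂ : G₂ ≤ 3 * (B + α ^ 2 * A_Q + m ^ 2 * A)) (hG₂nn : 0 ≤ G₂) (hAQ : A_Q ≤ eₜ * A) (heₜ0 : 0 ≤ eₜ) (heₜ : eₜ ≤ e₂)
    (hA : A ≤ (2 * sp ^ 2 / μ₀) ^ 2 * B) (hB0 : 0 ≤ B) (hμ₀ : 0 < μ₀) (hαsp : α * sp ^ 2 = aS) (haS0 : 0 ≤ aS) (haS : aS ≤ a)
    (hmsp : m * sp ^ 2 = 1) (hB : B ≤ F ^ 2 * E ^ 2 * (K * N)) (hE : 0 ≤ E) (hK : 0 ≤ K) (hF : 0 ≤ F) :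
    vx ≤ Real.sqrt (C₀ * (3 * (1 + 4 * (a ^ 2 * e₂ + 1) / μ₀ ^ 2)) * K) * sp ^ 2 * E * F := by
  have he₂ : 0 ≤ e₂ := heₜ0.trans heₜ
  have hae₂ : 0 ≤ a ^ 2 * e₂ := mul_nonneg (sq_nonneg a) he₂
  set C₂ : ℝ := 3 * (1 + 4 * (a ^ 2 * e₂ + 1) / μ₀ ^ 2) with hC₂
  have hC₂nn : 0 ≤ C₂ := by positivity
  have hcoef : (α ^ 2 * eₜ + m ^ 2) * (2 * sp ^ 2 / μ₀) ^ 2 = 4 * ((α * sp ^ 2) ^ 2 * eₜ + (m * sp ^ 2) ^ 2) / μ₀ ^ 2 := by ring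
  rw [hαsp, hmsp, one_pow] at hcoef
  have haS2 : aS ^ 2 * eₜ ≤ a ^ 2 * e₂ :=
    (mul_le_mul_of_nonneg_right (pow_le_pow_left₀ haS0 haS 2) heₜ0).trans (mul_le_mul_of_nonneg_left heₜ (sq_nonneg a))
  have hcoef_le : (α ^ 2 * eₜ + m ^ 2) * (2 * sp ^ 2 / μ₀) ^ 2 ≤ 4 * (a ^ 2 * e₂ + 1) / μ₀ ^ 2 := by
    rw [hcoef]
    exact div_le_div_of_nonneg_right (by linarith) (sq_nonneg _)
  have hG₂' : G₂ ≤ C₂ * B := by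
    have h1 : α ^ 2 * A_Q ≤ α ^ 2 * (eₜ * A) := mul_le_mul_of_nonneg_left hAQ (sq_nonneg _)
    have h2 : (α ^ 2 * eₜ + m ^ 2) * A ≤ (α ^ 2 * eₜ + m ^ 2) * ((2 * sp ^ 2 / μ₀) ^ 2 * B) :=
      mul_le_mul_of_nonneg_left hA (by positivity)
    have h3 : (α ^ 2 * eₜ + m ^ 2) * (2 * sp ^ 2 / μ₀) ^ 2 * B ≤ 4 * (a ^ 2 * e₂ + 1) / μ₀ ^ 2 * B :=
      mul_le_mul_of_nonneg_right hcoef_le hB0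
    calc G₂ ≤ 3 * (B + α ^ 2 * A_Q + m ^ 2 * A) := hG₂
      _ ≤ 3 * (B + (α ^ 2 * eₜ + m ^ 2) * ((2 * sp ^ 2 / μ₀) ^ 2 * B)) := by linarith
      _ = 3 * (B + (α ^ 2 * eₜ + m ^ 2) * (2 * sp ^ 2 / μ₀) ^ 2 * B) := by ring
      _ ≤ 3 * (B + 4 * (a ^ 2 * e₂ + 1) / μ₀ ^ 2 * B) := by linarith
      _ = C₂ * B := by rw [hC₂]; ring
  have hsq : vx ^ 2 ≤ (Real.sqrt (C₀ * C₂ * K) * sp ^ 2 * E * F) ^ 2 := by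
    have h1 : W * G₂ ≤ C₀ * (sp ^ 4 / N) * (C₂ * B) := mul_le_mul hW hG₂' hG₂nn (by positivity)
    have h2 : C₀ * (sp ^ 4 / N) * (C₂ * B) ≤ C₀ * (sp ^ 4 / N) * (C₂ * (F ^ 2 * E ^ 2 * (K * N))) :=
      mul_le_mul_of_nonneg_left (mul_le_mul_of_nonneg_left hB hC₂nn) (by positivity)
    have h3 : C₀ * (sp ^ 4 / N) * (C₂ * (F ^ 2 * E ^ 2 * (K * N))) = (Real.sqrt (C₀ * C₂ * K) * sp ^ 2 * E * F) ^ 2 := by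
      rw [mul_pow, mul_pow, mul_pow, Real.sq_sqrt (by positivity)]
      field_simp
    linarith
  exact le_of_pow_le_pow_left₀ two_ne_zero (by positivity) hsq

set_option maxHeartbeats 800000 in
/-- **p. 326 / C2 p. 263: THE SUP-NORM DECAY OF THE CUBE NEUMANN PROPAGATORS `G_k(□,u)` AT SMALL NON-FLAT FIELDS, `k`-UNIFORM, IN
OPERATOR FORM** (the VALUE member of [Balaban1983RegularityDecay] (1.10) for p31's `G_k(□,u) = gBox (α_kL^{kD}) ε⁻¹ u k □` on a
cube `□ = c·L^k + Π_i[0, L^kM_i)` of the fine torus that fits and is shorter than the torus, `D = d + 1 ≤ 3`): there are `t₀, c₀ > 0`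
depending on `d, L, a` only such that for every volume, every `1 ≤ k ≤ m + K`, every such cube, every `U(1)` field bondwise small INSIDE the
cube (`|u_b − 1| ≤ T` on the in-block bonds of `□*`, `|u(Γ^{(k)}_{x_k,x}) − 1| ≤ δ` on `□`, `2(L^k−1)L^k·D·T² + 2δ² ≤ 1/2` — p34's
hypotheses), every `x` and every source `f` with `|f| ≤ F` vanishing at `ℓ^∞`-distance `< D₀` from `x`:
`|(G_k(□,u)f)(x)| ≤ c₀(L^kε)²e^{−t₀D₀/L^k}F` — p31's displayed hypothesis (H1.10) at `X = □_α` and non-flat `u`. C2 p. 263: *"a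
straightforward application of the random walk expansion of [6] shows that |(G_{k,loc}(u)f)(x)| ≦ ce^{−c dist(suppt f,x)}‖f‖_∞ (2.30)"* —
here by Kato's inequality on the cube, [6]'s box Green's function (the free tilted row of the companion file) and p34's weighted `ℓ²`
(Agmon) bound on the region. [cite: BalabanImbrieJaffe1988, (2.30) p.263] -/
theorem decay110_smallField_cube (d ℓ : ℕ) (hd3 : d + 1 ≤ 3) (hℓ : 1 ≤ ℓ) {a : ℝ} (ha : 0 < a) :
    ∃ t₀ c₀ : ℝ, 0 < t₀ ∧ 0 < c₀ ∧ ∀ (P : Params) (hPd : P.d = d + 1), P.L = ℓ + 1 →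
      ∀ k : ℕ, 1 ≤ k → k ≤ P.m + P.K → ∀ (c M : Fin (d + 1) → ℕ), (∀ i, 1 ≤ M i) →
        (∀ i, c i * P.L ^ k + P.L ^ k * M i ≤ P.sitesPerDir 0) → (∀ i, P.L ^ k * M i < P.sitesPerDir 0) →
        ∀ (U : GaugeField P 0 U1) (T δ : ℝ),
          (∀ b ∈ starB (cubeT hPd (P.L ^ k) c fun i => P.L ^ k * M i), blkIter k b.src = blkIter k b.tgt → ‖toC (U b) - 1‖ ≤ T) →
          (∀ y ∈ cubeT hPd (P.L ^ k) c (fun i => P.L ^ k * M i), ‖holCK U k y - 1‖ ≤ δ) →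
          2 * (((P.L : ℝ) ^ k - 1) * (P.L : ℝ) ^ k) * P.d * T ^ 2 + 2 * δ ^ 2 ≤ 1 / 2 →
          ∀ (x : Balaban1983to89.Site P 0) (f : Balaban1983to89.Site P 0 → ℂ) (F D₀ : ℝ),
            (∀ z, ‖f z‖ ≤ F) → (∀ z, f z ≠ 0 → D₀ ≤ (supDist x z : ℝ)) →
            ‖(gBox (B1RG242Torus.α P a k * (P.L : ℝ) ^ (k * P.d)) P.eps⁻¹ U k (cubeT hPd (P.L ^ k) c fun i => P.L ^ k * M i) *ᵥ f) x‖
              ≤ c₀ * P.spacing k ^ 2 * Real.exp (-(t₀ * D₀ / (P.L : ℝ) ^ k)) * F := by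
  obtain ⟨t₁, C₀, ht₁, hC₀, hR⟩ := tilted_row_boxR_sq_le d ℓ hd3 hℓ ha
  set μ₁ : ℝ := min (1 / 4) (a / 8) with hμ₁
  have hμ₁pos : 0 < μ₁ := lt_min (by norm_num) (by positivity)
  set t : ℝ := min (min t₁ 1) (μ₁ / ((2 * ((d + 1 : ℕ) : ℝ) + a) * Real.exp 1)) with htdef
  have htpos : 0 < t := lt_min (lt_min ht₁ one_pos) (by positivity)
  have ht₁' : t ≤ t₁ := (min_le_left _ _).trans (min_le_left _ _)
  have ht1 : t ≤ 1 := (min_le_left _ _).trans (min_le_right _ _)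
  have htμ' : t ≤ μ₁ / ((2 * ((d + 1 : ℕ) : ℝ) + a) * Real.exp 1) := min_le_right _ _
  set Kt : ℝ := (2 * (1 + ((d + 1 : ℕ) : ℝ) / t)) ^ (d + 1) with hKt
  have hKtpos : 0 < Kt := by positivity
  set C₂ : ℝ := 3 * (1 + 4 * (a ^ 2 * Real.exp 2 + 1) / μ₁ ^ 2) with hC₂
  have hC₂pos : 0 < C₂ := by positivity
  refine ⟨t / 2, Real.sqrt (C₀ * C₂ * Kt), by positivity, Real.sqrt_pos.2 (by positivity), ?_⟩
  intro P hPd hPL k hk1 hk c M hM hfit hN U T δ hInt hTree hsmall x f F D₀ hF hsupp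
  -- the cube in the box file's spelling `n = (ℓ+1)^k`
  have e1 : P.L ^ k = (ℓ + 1) ^ k := by rw [hPL]
  rw [e1] at hfit hN hInt hTree ⊢
  have hn : (ℓ + 1) ^ k = P.L ^ k := e1.symm
  have hk0 : 0 + k ≤ P.m + P.K := by omega
  have hn1 : 1 ≤ (ℓ + 1) ^ k := Nat.one_le_pow _ _ (by omega)
  have hLpos : (0 : ℝ) < P.L := P.cast_L_pos
  have hL1 : (1 : ℝ) < P.L := B1RG242Torus.one_lt_cast_L P
  have hLreal : ((ℓ : ℝ) + 1) = (P.L : ℝ) := by rw [hPL]; push_cast; ring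
  have hncast : ((((ℓ + 1) ^ k : ℕ)) : ℝ) = (P.L : ℝ) ^ k := by rw [hPL]; push_cast; ring
  have hnr : 0 < (P.L : ℝ) ^ k := pow_pos hLpos k
  have hN' : 0 < ((P.L : ℝ) ^ k) ^ (d + 1) := pow_pos hnr _
  have hεpos : 0 < P.eps := P.eps_pos
  have hsp : 0 < P.spacing k := P.spacing_pos k
  have hspdef : P.spacing k = (P.L : ℝ) ^ k * P.eps := rfl
  have hF0 : 0 ≤ F := (norm_nonneg _).trans (hF x)
  have hα : 0 < B1RG242Torus.α P a k := mul_pos (B1.aSeq_pos ha hL1 hk1) (inv_pos.2 (pow_pos hsp 2))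
  have hNd : 0 < (P.L : ℝ) ^ (k * P.d) := pow_pos hLpos _
  have ha' : 0 < B1RG242Torus.α P a k * (P.L : ℝ) ^ (k * P.d) := mul_pos hα hNd
  have hc : P.eps⁻¹ ≠ 0 := inv_ne_zero hεpos.ne'
  have hm : 0 < (P.spacing k ^ 2)⁻¹ := inv_pos.2 (pow_pos hsp 2)
  have hαdef : B1RG242Torus.α P a k = B1.aSeq a P.L k * (P.spacing k ^ 2)⁻¹ := rfl
  set Ω : Finset (Balaban1983to89.Site P 0) := cubeT hPd ((ℓ + 1) ^ k) c (fun i => (ℓ + 1) ^ k * M i) with hΩdef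
  have hΩ : IsBlockUnion k Ω := isBlockUnion_cubeT hPd hk hn hfit
  -- the RHS is nonnegative; the trivial case `x ∉ □`
  have hRHS : 0 ≤ Real.sqrt (C₀ * C₂ * Kt) * P.spacing k ^ 2 * Real.exp (-(t / 2 * D₀ / (P.L : ℝ) ^ k)) * F := by positivity
  by_cases hx : x ∈ Ω
  swap
  · rw [gBox_mulVec_eq_zero_of_not_mem hk0 hc ha' U hΩ f hx, norm_zero]; exact hRHS
  obtain ⟨zx, hzx, hxz⟩ := (mem_cubeT hPd).1 hx
  -- the objects
  set α₀ : ℝ := B1RG242Torus.α P a k with hα₀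
  set m₀ : ℝ := (P.spacing k ^ 2)⁻¹ with hm₀
  set a' : ℝ := α₀ * (P.L : ℝ) ^ (k * P.d) with ha'def
  set φ : Balaban1983to89.Site P 0 → ℂ := gBox a' P.eps⁻¹ U k Ω *ᵥ f with hφ
  set v : Balaban1983to89.Site P 0 → ℝ := fun z => ‖φ z‖ with hv
  set QQ : Matrix (Balaban1983to89.Site P 0) (Balaban1983to89.Site P 0) ℝ := B1RG242Torus.Qks P k * B1RG242Torus.Qk P k with hQQ
  set ω : Balaban1983to89.Site P 0 → ℝ := fun z => Real.exp ((-t) * (supDist x z : ℝ) / (P.L : ℝ) ^ k) with hω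
  set g : Balaban1983to89.Site P 0 → ℝ := fun z => ‖f z‖ + α₀ * (QQ *ᵥ v) z + m₀ * v z with hg
  have hωpos : ∀ z, 0 < ω z := fun z => Real.exp_pos _
  have hvnn : ∀ z, 0 ≤ v z := fun z => norm_nonneg _
  have hQQnn : ∀ z, 0 ≤ (QQ *ᵥ v) z := fun z => by
    rw [hQQ, towerQQ_mulVec_apply hk]; exact mul_nonneg (by positivity) (sum_nonneg fun _ _ => hvnn _)
  have hgnn : ∀ z, 0 ≤ g z := fun z => by
    simp only [hg]; exact add_nonneg (add_nonneg (norm_nonneg _) (mul_nonneg hα.le (hQQnn z))) (mul_nonneg hm.le (hvnn z))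
  -- STEP 1: the equation on the cube, `(χD_u)ᴴ(χD_u)φ = f − a′(Q_k|_□)ᴴ(Q_k|_□)φ` at the points of `□`
  have heq : nOp a' P.eps⁻¹ U k Ω *ᵥ φ = proj Ω *ᵥ f := nOp_mulVec_gBox_mulVec hk0 hc ha' U hΩ f
  have hDD : ∀ y ∈ Ω, (((dN P.eps⁻¹ U Ω)ᴴ * dN P.eps⁻¹ U Ω) *ᵥ φ) y = f y - (a' : ℂ) * (((qMatK U k Ω)ᴴ * qMatK U k Ω) *ᵥ φ) y := by
    intro y hy
    have h := congr_fun heq y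
    rw [nOp_eq, add_mulVec, smul_mulVec, Pi.add_apply, Pi.smul_apply, smul_eq_mul, proj_mulVec, if_pos hy] at h
    linear_combination h
  -- STEP 2: Kato on the cube, `ε⁻²Σ_μ(in-cube differences of |φ|) + m₀|φ| ≤ g` at the points of `□`
  have hKato : ∀ y ∈ Ω, (P.eps⁻¹) ^ 2 * (∑ μ : Fin P.d,
      ((if (⟨y, μ⟩ : PBond P 0) ∈ starB Ω then v y - v (y.shift μ) else 0) +
        (if (⟨y.unshift μ, μ⟩ : PBond P 0) ∈ starB Ω then v y - v (y.unshift μ) else 0))) + m₀ * v y ≤ g y := by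
    intro y hy
    refine (kato_region P.eps⁻¹ m₀ U Ω φ y).trans ?_
    rw [hDD y hy]
    have hX := norm_gram_qMatK_region_mulVec_le hk U Ω φ y
    have h1 : ‖(a' : ℂ) * (((qMatK U k Ω)ᴴ * qMatK U k Ω) *ᵥ φ) y‖ ≤ α₀ * (QQ *ᵥ v) y := by
      rw [norm_mul, Complex.norm_real, Real.norm_of_nonneg ha'.le]
      refine (mul_le_mul_of_nonneg_left hX ha'.le).trans (le_of_eq ?_)
      rw [ha'def, mul_assoc, mul_inv_cancel_left₀ hNd.ne']
    have h2 : ‖((m₀ : ℝ) : ℂ) * φ y‖ = m₀ * v y := by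
      rw [norm_mul, Complex.norm_real, Real.norm_of_nonneg hm.le]
    calc ‖f y - (a' : ℂ) * (((qMatK U k Ω)ᴴ * qMatK U k Ω) *ᵥ φ) y + ((m₀ : ℝ) : ℂ) * φ y‖
        ≤ ‖f y - (a' : ℂ) * (((qMatK U k Ω)ᴴ * qMatK U k Ω) *ᵥ φ) y‖ + ‖((m₀ : ℝ) : ℂ) * φ y‖ := norm_add_le _ _
      _ ≤ ‖f y‖ + ‖(a' : ℂ) * (((qMatK U k Ω)ᴴ * qMatK U k Ω) *ᵥ φ) y‖ + ‖((m₀ : ℝ) : ℂ) * φ y‖ :=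
          add_le_add (norm_sub_le _ _) le_rfl
      _ ≤ g y := by rw [h2]; simp only [hg]; linarith [h1]
  -- STEP 3: transfer to [6]'s box — `H_□V ≤ (L^kε)²·g∘cubePt` for `V = |φ|∘cubePt`, `H_□ = L^{2k}(−Δ^N_□) + 1`
  set V : ↥(boxDom (fun i => (ℓ + 1) ^ k * M i)) → ℝ := fun y => v (cubePt hPd ((ℓ + 1) ^ k) c y.1) with hV
  set Gb : ↥(boxDom (fun i => (ℓ + 1) ^ k * M i)) → ℝ := fun y => P.spacing k ^ 2 * g (cubePt hPd ((ℓ + 1) ^ k) c y.1) with hGb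
  have hbox : ∀ y, (boxOpR ((ℓ + 1) ^ k) 0 1 M *ᵥ V) y ≤ Gb y := by
    intro y
    have hy : cubePt hPd ((ℓ + 1) ^ k) c y.1 ∈ Ω := cubePt_mem_cubeT hPd y.2
    have hK := hKato _ hy
    rw [boxH_mulVec, one_mul, ← lapPart_cubePt hPd hN v y, hncast]
    simp only [hGb, hV]
    -- `n²S + V = (L^kε)²(ε⁻²S + m₀V)`
    have e : ((P.L : ℝ) ^ k) ^ 2 * (∑ μ : Fin P.d,
        ((if (⟨cubePt hPd ((ℓ + 1) ^ k) c y.1, μ⟩ : PBond P 0) ∈ starB Ω then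
            v (cubePt hPd ((ℓ + 1) ^ k) c y.1) - v ((cubePt hPd ((ℓ + 1) ^ k) c y.1).shift μ) else 0) +
          (if (⟨(cubePt hPd ((ℓ + 1) ^ k) c y.1).unshift μ, μ⟩ : PBond P 0) ∈ starB Ω then
            v (cubePt hPd ((ℓ + 1) ^ k) c y.1) - v ((cubePt hPd ((ℓ + 1) ^ k) c y.1).unshift μ) else 0))) +
        v (cubePt hPd ((ℓ + 1) ^ k) c y.1) =
      P.spacing k ^ 2 * ((P.eps⁻¹) ^ 2 * (∑ μ : Fin P.d,
        ((if (⟨cubePt hPd ((ℓ + 1) ^ k) c y.1, μ⟩ : PBond P 0) ∈ starB Ω then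
            v (cubePt hPd ((ℓ + 1) ^ k) c y.1) - v ((cubePt hPd ((ℓ + 1) ^ k) c y.1).shift μ) else 0) +
          (if (⟨(cubePt hPd ((ℓ + 1) ^ k) c y.1).unshift μ, μ⟩ : PBond P 0) ∈ starB Ω then
            v (cubePt hPd ((ℓ + 1) ^ k) c y.1) - v ((cubePt hPd ((ℓ + 1) ^ k) c y.1).unshift μ) else 0))) +
        m₀ * v (cubePt hPd ((ℓ + 1) ^ k) c y.1)) := by
      rw [hm₀, hspdef]; field_simp
    rw [e]
    exact mul_le_mul_of_nonneg_left hK (pow_pos hsp 2).le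
  -- STEP 4: the comparison principle on the box, `|φ(x)| = V(z_x) ≤ (R_□G)(z_x) = Σ_y R_□(z_x,y)G(y)`
  set R : Matrix ↥(boxDom (fun i => (ℓ + 1) ^ k * M i)) ↥(boxDom (fun i => (ℓ + 1) ^ k * M i)) ℝ :=
    (boxOpR ((ℓ + 1) ^ k) 0 1 M)⁻¹ with hRdef
  have hvx : v x ≤ ∑ y, R ⟨zx, hzx⟩ y * Gb y := by
    have h := le_boxR_mulVec (n := (ℓ + 1) ^ k) (M := M) hn1 hM one_pos hbox ⟨zx, hzx⟩
    rw [← hxz]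
    exact h
  -- STEP 5: Cauchy–Schwarz with the box weight `w = e^{t|z_x−·|_∞/L^k}`; the second factor is read back on the torus
  set w : ↥(boxDom (fun i => (ℓ + 1) ^ k * M i)) → ℝ := fun y => Real.exp (t * supNorm (zx - y.1) / (P.L : ℝ) ^ k) with hw
  have hwpos : ∀ y, 0 < w y := fun y => Real.exp_pos _
  have hCS : (∑ y, R ⟨zx, hzx⟩ y * Gb y) ^ 2 ≤ (∑ y, (w y * R ⟨zx, hzx⟩ y) ^ 2) * ∑ y, ((w y)⁻¹ * Gb y) ^ 2 := by
    have e : ∑ y, R ⟨zx, hzx⟩ y * Gb y = ∑ y, (w y * R ⟨zx, hzx⟩ y) * ((w y)⁻¹ * Gb y) :=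
      sum_congr rfl fun y _ => by
        rw [show w y * R ⟨zx, hzx⟩ y * ((w y)⁻¹ * Gb y) = (w y * (w y)⁻¹) * (R ⟨zx, hzx⟩ y * Gb y) by ring,
          mul_inv_cancel₀ (hwpos y).ne', one_mul]
    rw [e]
    exact sum_mul_sq_le_sq_mul_sq _ _ _
  -- the tilted row of `R_□` (companion file, §7)
  have hW : ∑ y, (w y * R ⟨zx, hzx⟩ y) ^ 2 ≤ C₀ / ((P.L : ℝ) ^ k) ^ (d + 1) := by
    have h := hR k hk1 M hM t htpos.le ht₁' ⟨zx, hzx⟩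
    rw [hLreal] at h
    exact h
  -- the source side on the torus: `Σ_y (w(y)⁻¹G(y))² ≤ (L^kε)⁴·Σ_{x′}(ω(x′)g(x′))²`
  have hG2box : ∑ y, ((w y)⁻¹ * Gb y) ^ 2 ≤ P.spacing k ^ 4 * ∑ x', (ω x' * g x') ^ 2 := by
    have hpt : ∀ y : ↥(boxDom (fun i => (ℓ + 1) ^ k * M i)), ((w y)⁻¹ * Gb y) ^ 2 ≤
        P.spacing k ^ 4 * (ω (cubePt hPd ((ℓ + 1) ^ k) c y.1) * g (cubePt hPd ((ℓ + 1) ^ k) c y.1)) ^ 2 := by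
      intro y
      have hwy : (w y)⁻¹ ≤ ω (cubePt hPd ((ℓ + 1) ^ k) c y.1) := by
        simp only [hw, hω]
        rw [← Real.exp_neg, Real.exp_le_exp, ← hxz]
        have hd := supDist_cubePt_le hPd hfit hzx y.2
        have : t * (supDist (cubePt hPd ((ℓ + 1) ^ k) c zx) (cubePt hPd ((ℓ + 1) ^ k) c y.1) : ℝ) / (P.L : ℝ) ^ k ≤
            t * supNorm (zx - y.1) / (P.L : ℝ) ^ k :=
          div_le_div_of_nonneg_right (mul_le_mul_of_nonneg_left hd htpos.le) hnr.le
        rw [show (-t) * (supDist (cubePt hPd ((ℓ + 1) ^ k) c zx) (cubePt hPd ((ℓ + 1) ^ k) c y.1) : ℝ) / (P.L : ℝ) ^ k =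
          -(t * (supDist (cubePt hPd ((ℓ + 1) ^ k) c zx) (cubePt hPd ((ℓ + 1) ^ k) c y.1) : ℝ) / (P.L : ℝ) ^ k) by ring]
        linarith
      have hGy : 0 ≤ Gb y := mul_nonneg (pow_pos hsp 2).le (hgnn _)
      calc ((w y)⁻¹ * Gb y) ^ 2 ≤ (ω (cubePt hPd ((ℓ + 1) ^ k) c y.1) * Gb y) ^ 2 :=
            pow_le_pow_left₀ (mul_nonneg (inv_pos.2 (hwpos y)).le hGy) (mul_le_mul_of_nonneg_right hwy hGy) 2
        _ = P.spacing k ^ 4 * (ω (cubePt hPd ((ℓ + 1) ^ k) c y.1) * g (cubePt hPd ((ℓ + 1) ^ k) c y.1)) ^ 2 := by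
            simp only [hGb]; ring
    refine (sum_le_sum fun y _ => hpt y).trans ?_
    rw [← mul_sum]
    refine mul_le_mul_of_nonneg_left ?_ (by positivity)
    exact sum_box_le_sum_torus hPd hfit (g := fun x' => (ω x' * g x') ^ 2) fun _ => sq_nonneg _
  have hv2 : v x ^ 2 ≤ (C₀ * (P.spacing k ^ 4 / ((P.L : ℝ) ^ k) ^ (d + 1))) * ∑ x', (ω x' * g x') ^ 2 := by
    calc v x ^ 2 ≤ (∑ y, R ⟨zx, hzx⟩ y * Gb y) ^ 2 := pow_le_pow_left₀ (hvnn x) hvx 2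
      _ ≤ (∑ y, (w y * R ⟨zx, hzx⟩ y) ^ 2) * ∑ y, ((w y)⁻¹ * Gb y) ^ 2 := hCS
      _ ≤ (C₀ / ((P.L : ℝ) ^ k) ^ (d + 1)) * (P.spacing k ^ 4 * ∑ x', (ω x' * g x') ^ 2) :=
          mul_le_mul hW hG2box (sum_nonneg fun _ _ => sq_nonneg _) (by positivity)
      _ = (C₀ * (P.spacing k ^ 4 / ((P.L : ℝ) ^ k) ^ (d + 1))) * ∑ x', (ω x' * g x') ^ 2 := by ring
  -- STEP 6: the three pieces of `Σ_z(ω(z)g(z))²`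
  set A : ℝ := ∑ z, (ω z * v z) ^ 2 with hA
  set AQ : ℝ := ∑ z, (ω z * (QQ *ᵥ v) z) ^ 2 with hAQ
  set B : ℝ := ∑ z, (ω z * ‖f z‖) ^ 2 with hB
  have hB0 : 0 ≤ B := sum_nonneg fun z _ => sq_nonneg _
  have hG₂ : ∑ z, (ω z * g z) ^ 2 ≤ 3 * (B + α₀ ^ 2 * AQ + m₀ ^ 2 * A) := by
    have h3 : ∀ p q r : ℝ, (p + q + r) ^ 2 ≤ 3 * p ^ 2 + 3 * q ^ 2 + 3 * r ^ 2 := fun p q r => by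
      nlinarith [sq_nonneg (p - q), sq_nonneg (q - r), sq_nonneg (p - r)]
    calc ∑ z, (ω z * g z) ^ 2
        ≤ ∑ z, (3 * (ω z * ‖f z‖) ^ 2 + 3 * α₀ ^ 2 * (ω z * (QQ *ᵥ v) z) ^ 2 + 3 * m₀ ^ 2 * (ω z * v z) ^ 2) :=
          sum_le_sum fun z _ => by
            have e : ω z * g z = ω z * ‖f z‖ + α₀ * (ω z * (QQ *ᵥ v) z) + m₀ * (ω z * v z) := by
              simp only [hg]; ring
            rw [e]
            refine (h3 _ _ _).trans (le_of_eq ?_)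
            ring
      _ = 3 * (B + α₀ ^ 2 * AQ + m₀ ^ 2 * A) := by
          rw [sum_add_distrib, sum_add_distrib, ← mul_sum, ← mul_sum, ← mul_sum, hB, hAQ, hA]
          ring
  -- (6a) the block piece: `A_Q ≤ e^{2t}A`
  have hoscω : ∀ z z' : Balaban1983to89.Site P 0,
      Balaban1983to89.Site.proj k k z' = Balaban1983to89.Site.proj k k z → ω z ≤ Real.exp t * ω z' := by
    intro z z' hzz
    have h1 := weight_block_osc htpos.le hk x z' z hzz.symm
    rw [← Real.exp_add, Real.exp_le_exp] at h1
    show Real.exp _ ≤ Real.exp t * Real.exp _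
    rw [← Real.exp_add, Real.exp_le_exp]
    have e1' : (-t) * (supDist x z : ℝ) / (P.L : ℝ) ^ k = -(t * (supDist x z : ℝ) / (P.L : ℝ) ^ k) := by ring
    have e2' : (-t) * (supDist x z' : ℝ) / (P.L : ℝ) ^ k = -(t * (supDist x z' : ℝ) / (P.L : ℝ) ^ k) := by ring
    rw [e1', e2']
    linarith
  have hAQle : AQ ≤ Real.exp (2 * t) * A := tilted_sq_QQ_le hk hωpos hoscω v
  -- (6b) the source piece: `B ≤ F²e^{−tD₀/L^k}·K_tL^{kD}`
  have hBle : B ≤ F ^ 2 * Real.exp (-(t / 2 * D₀ / (P.L : ℝ) ^ k)) ^ 2 * (Kt * ((P.L : ℝ) ^ k) ^ (d + 1)) := by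
    have hE : Real.exp (-(t / 2 * D₀ / (P.L : ℝ) ^ k)) ^ 2 = Real.exp (-(t * D₀ / (P.L : ℝ) ^ k)) := by
      rw [sq, ← Real.exp_add]; congr 1; ring
    rw [hE]
    have hpt : ∀ z, (ω z * ‖f z‖) ^ 2 ≤ F ^ 2 * Real.exp (-(t * D₀ / (P.L : ℝ) ^ k)) * ω z := by
      intro z
      by_cases hz : f z = 0
      · rw [hz, norm_zero, mul_zero, sq, zero_mul]
        exact mul_nonneg (mul_nonneg (sq_nonneg _) (Real.exp_pos _).le) (hωpos z).le
      · have hDz := hsupp z hz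
        have hω2 : ω z ^ 2 ≤ Real.exp (-(t * D₀ / (P.L : ℝ) ^ k)) * ω z := by
          show Real.exp _ ^ 2 ≤ Real.exp _ * Real.exp _
          rw [sq, ← Real.exp_add, ← Real.exp_add, Real.exp_le_exp]
          have : t * D₀ / (P.L : ℝ) ^ k ≤ t * (supDist x z : ℝ) / (P.L : ℝ) ^ k :=
            div_le_div_of_nonneg_right (mul_le_mul_of_nonneg_left hDz htpos.le) hnr.le
          have e1' : (-t) * (supDist x z : ℝ) / (P.L : ℝ) ^ k = -(t * (supDist x z : ℝ) / (P.L : ℝ) ^ k) := by ring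
          rw [e1']
          linarith
        have hf2 : ‖f z‖ ^ 2 ≤ F ^ 2 := pow_le_pow_left₀ (norm_nonneg _) (hF z) 2
        calc (ω z * ‖f z‖) ^ 2 = ω z ^ 2 * ‖f z‖ ^ 2 := mul_pow _ _ _
          _ ≤ (Real.exp (-(t * D₀ / (P.L : ℝ) ^ k)) * ω z) * F ^ 2 :=
              mul_le_mul hω2 hf2 (sq_nonneg _) (mul_nonneg (Real.exp_pos _).le (hωpos z).le)
          _ = F ^ 2 * Real.exp (-(t * D₀ / (P.L : ℝ) ^ k)) * ω z := by ring
    have hsumω : ∑ z, ω z ≤ Kt * ((P.L : ℝ) ^ k) ^ (d + 1) := by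
      have h := sum_exp_neg_supDist_scale_le (P := P) htpos k x
      rw [hPd] at h
      have e : ∀ z, ω z = Real.exp (-(t * (supDist x z : ℝ) / (P.L : ℝ) ^ k)) := fun z => by
        simp only [hω]; congr 1; ring
      simp_rw [e]
      exact h
    calc B = ∑ z, (ω z * ‖f z‖) ^ 2 := hB
      _ ≤ ∑ z, F ^ 2 * Real.exp (-(t * D₀ / (P.L : ℝ) ^ k)) * ω z := sum_le_sum fun z _ => hpt z
      _ = F ^ 2 * Real.exp (-(t * D₀ / (P.L : ℝ) ^ k)) * ∑ z, ω z := by rw [mul_sum]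
      _ ≤ F ^ 2 * Real.exp (-(t * D₀ / (P.L : ℝ) ^ k)) * (Kt * ((P.L : ℝ) ^ k) ^ (d + 1)) :=
          mul_le_mul_of_nonneg_left hsumω (by positivity)
  -- (6c) the Agmon piece on the region (p34): `A ≤ (2(L^kε)²/μ₁)²B`
  have hAle : A ≤ (2 * P.spacing k ^ 2 / μ₁) ^ 2 * B := by
    have hst : |(-t)| ≤ t := by rw [abs_neg, abs_of_pos htpos]
    have hω₁ : ∀ b ∈ starB Ω, (ω b.tgt - ω b.src) ^ 2 ≤
        ((t / (P.L : ℝ) ^ k) ^ 2 * Real.exp (t / (P.L : ℝ) ^ k)) * (ω b.tgt * ω b.src) := fun b _ => weight_bond_osc_sq hst k x b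
    have hω₂ : ∀ z z' : Balaban1983to89.Site P 0, blkIter k z = blkIter k z' →
        (ω z - ω z') ^ 2 ≤ (t ^ 2 * Real.exp t) * (ω z * ω z') := fun z z' hzz => weight_block_osc_sq hst hk0 x z z' hzz
    have htμ : t ≤ min (1 / 4) (a / 8) / ((2 * P.d + a) * Real.exp 1) := by
      rw [hPd]; exact htμ'
    have hge := agmon_gap_region P ha hk1 htpos.le ht1 htμ
    have hν : 0 < μ₁ / (2 * P.spacing k ^ 2) := by positivity
    have hκ := sub_pos.1 (lt_of_lt_of_le hν hge)
    have hAg := agmon_weighted_region hk0 hΩ U hInt hTree hsmall hc ha' hωpos (by positivity) (by positivity) hω₁ hω₂ hκ f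
    have hAg' : A ≤ B / (μ₁ / (2 * P.spacing k ^ 2)) ^ 2 := by
      refine hAg.trans (div_le_div_of_nonneg_left hB0 (pow_pos hν 2) ?_)
      exact pow_le_pow_left₀ hν.le hge 2
    refine hAg'.trans (le_of_eq ?_)
    field_simp
  -- STEP 7: the scalar assembly
  have hαsp : α₀ * P.spacing k ^ 2 = B1.aSeq a P.L k := by
    rw [hαdef, hm₀, inv_mul_cancel_right₀ (pow_pos hsp 2).ne']
  have hmsp : m₀ * P.spacing k ^ 2 = 1 := by rw [hm₀]; exact inv_mul_cancel₀ (pow_pos hsp 2).ne'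
  have he2t : Real.exp (2 * t) ≤ Real.exp 2 := Real.exp_le_exp.2 (by linarith)
  exact assembly_arith_cube hv2 le_rfl hN' hC₀.le hG₂ (sum_nonneg fun z _ => sq_nonneg _) hAQle (Real.exp_pos _).le he2t hAle hB0
    hμ₁pos hαsp (B1.aSeq_pos ha hL1 hk1).le (B1.aSeq_le ha hL1 k hk1) hmsp hBle (Real.exp_pos _).le hKtpos.le hF0

end Assembly

/-! ## §5 Corollaries: p31's displayed hypothesis (H1.10) verbatim, and the bound in every gauge -/

section Corollaries

open B3Bound323ZeroTorus (T_eq_supDist)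
open BIJ88DeltaLoc234Torus (mulOp gBox_gaugeAct)
open GaugeField (gaugeAct)

/-- **(H1.10) AT `X = □_α`, NON-FLAT SMALL `u` — IN THE BINDER SHAPE CONSUMED BY p31's `BIJ88DeltaLocClose235General`**
(`opDecay230_of_input`, `decay236_of_input`, … take, per cube, `∀ x f F D, (∀ y, ‖f y‖ ≤ F) → (∀ y, f y ≠ 0 → D ≤ T(x,y)) →
‖(G_k(□,u)f)(x)‖ ≤ (L^kε)²·(c₀e^{−δ₀D/L^k}F)` with the torus sup-distance `T = B5Ineq137Torus.T P 0`): the theorem above, with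
`T(x,y) = |x − y|_∞` (`B3Bound323ZeroTorus.T_eq_supDist`) and the factors reordered.  [6] (1.10) p. 573: *"|(G_k(Ω, A)f)(x)| ≤ c₀exp(−δ₀
dist(x, supp f))‖f‖_∞"*, here for `Ω = □` a cube of the `(L^kε)`-lattice and the small non-flat `u` of the hypotheses.
[cite: Balaban1983RegularityDecay, (1.10) p.573] -/
theorem decay110_smallField_cube_input (d ℓ : ℕ) (hd3 : d + 1 ≤ 3) (hℓ : 1 ≤ ℓ) {a : ℝ} (ha : 0 < a) :
    ∃ δ₀ c₀ : ℝ, 0 < δ₀ ∧ 0 < c₀ ∧ ∀ (P : Params) (hPd : P.d = d + 1), P.L = ℓ + 1 →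
      ∀ k : ℕ, 1 ≤ k → k ≤ P.m + P.K → ∀ (c M : Fin (d + 1) → ℕ), (∀ i, 1 ≤ M i) →
        (∀ i, c i * P.L ^ k + P.L ^ k * M i ≤ P.sitesPerDir 0) → (∀ i, P.L ^ k * M i < P.sitesPerDir 0) →
        ∀ (U : GaugeField P 0 U1) (T δ : ℝ),
          (∀ b ∈ starB (cubeT hPd (P.L ^ k) c fun i => P.L ^ k * M i), blkIter k b.src = blkIter k b.tgt → ‖toC (U b) - 1‖ ≤ T) →
          (∀ y ∈ cubeT hPd (P.L ^ k) c (fun i => P.L ^ k * M i), ‖holCK U k y - 1‖ ≤ δ) →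
          2 * (((P.L : ℝ) ^ k - 1) * (P.L : ℝ) ^ k) * P.d * T ^ 2 + 2 * δ ^ 2 ≤ 1 / 2 →
          ∀ (x : Balaban1983to89.Site P 0) (f : Balaban1983to89.Site P 0 → ℂ) (F D : ℝ), (∀ y, ‖f y‖ ≤ F) →
            (∀ y, f y ≠ 0 → D ≤ B5Ineq137Torus.T P 0 x y) →
            ‖(gBox (B1RG242Torus.α P a k * (P.L : ℝ) ^ (k * P.d)) P.eps⁻¹ U k (cubeT hPd (P.L ^ k) c fun i => P.L ^ k * M i) *ᵥ f) x‖
              ≤ P.spacing k ^ 2 * (c₀ * Real.exp (-(δ₀ * (((P.L : ℝ) ^ k)⁻¹ * D))) * F) := by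
  obtain ⟨t₀, c₀, ht₀, hc₀, h⟩ := decay110_smallField_cube d ℓ hd3 hℓ ha
  refine ⟨t₀, c₀, ht₀, hc₀, ?_⟩
  intro P hPd hPL k hk1 hk c M hM hfit hN U T δ hInt hTree hsmall x f F D hF hsupp
  have hsupp' : ∀ z, f z ≠ 0 → D ≤ (supDist x z : ℝ) := fun z hz => by rw [← T_eq_supDist]; exact hsupp z hz
  have hmain := h P hPd hPL k hk1 hk c M hM hfit hN U T δ hInt hTree hsmall x f F D hF hsupp'
  have e : t₀ * D / (P.L : ℝ) ^ k = t₀ * (((P.L : ℝ) ^ k)⁻¹ * D) := by rw [div_eq_mul_inv]; ring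
  rw [e] at hmain
  calc _ ≤ _ := hmain
    _ = _ := by ring

/-- **THE BOUND IN EVERY GAUGE**: `G_k(□,u^h) = M_hG_k(□,u)M_hᴴ` (p31 `BIJ88DeltaLoc234Torus.gBox_gaugeAct`, [I] (6.3.2)) and `M_hᴴf` has
the modulus and the support of `f`, so `G_k(□,u^h)` obeys the bound of `decay110_smallField_cube_input` for EVERY gauge transformation
`h` — the small-field conditions need only hold for a gauge-equivalent field ([I] p. 326: *"under the restriction (7.3.1) on the gauge
field"*, a restriction on `|F|`, i.e. on the orbit). [cite: BalabanImbrieJaffe1985, (6.3.2) p.320] -/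
theorem decay110_smallField_cube_gaugeAct (d ℓ : ℕ) (hd3 : d + 1 ≤ 3) (hℓ : 1 ≤ ℓ) {a : ℝ} (ha : 0 < a) :
    ∃ δ₀ c₀ : ℝ, 0 < δ₀ ∧ 0 < c₀ ∧ ∀ (P : Params) (hPd : P.d = d + 1), P.L = ℓ + 1 →
      ∀ k : ℕ, 1 ≤ k → k ≤ P.m + P.K → ∀ (c M : Fin (d + 1) → ℕ), (∀ i, 1 ≤ M i) →
        (∀ i, c i * P.L ^ k + P.L ^ k * M i ≤ P.sitesPerDir 0) → (∀ i, P.L ^ k * M i < P.sitesPerDir 0) →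
        ∀ (U : GaugeField P 0 U1) (T δ : ℝ),
          (∀ b ∈ starB (cubeT hPd (P.L ^ k) c fun i => P.L ^ k * M i), blkIter k b.src = blkIter k b.tgt → ‖toC (U b) - 1‖ ≤ T) →
          (∀ y ∈ cubeT hPd (P.L ^ k) c (fun i => P.L ^ k * M i), ‖holCK U k y - 1‖ ≤ δ) →
          2 * (((P.L : ℝ) ^ k - 1) * (P.L : ℝ) ^ k) * P.d * T ^ 2 + 2 * δ ^ 2 ≤ 1 / 2 →
          ∀ (h : GaugeTransf P 0 U1) (x : Balaban1983to89.Site P 0) (f : Balaban1983to89.Site P 0 → ℂ) (F D : ℝ),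
            (∀ y, ‖f y‖ ≤ F) → (∀ y, f y ≠ 0 → D ≤ B5Ineq137Torus.T P 0 x y) →
            ‖(gBox (B1RG242Torus.α P a k * (P.L : ℝ) ^ (k * P.d)) P.eps⁻¹ (gaugeAct h U) k
                (cubeT hPd (P.L ^ k) c fun i => P.L ^ k * M i) *ᵥ f) x‖
              ≤ P.spacing k ^ 2 * (c₀ * Real.exp (-(δ₀ * (((P.L : ℝ) ^ k)⁻¹ * D))) * F) := by
  obtain ⟨t₀, c₀, ht₀, hc₀, hmain⟩ := decay110_smallField_cube_input d ℓ hd3 hℓ ha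
  refine ⟨t₀, c₀, ht₀, hc₀, ?_⟩
  intro P hPd hPL k hk1 hk c M hM hfit hN U T δ hInt hTree hsmall h x f F D hF hsupp
  have hk0 : 0 + k ≤ P.m + P.K := by omega
  have hL1 : (1 : ℝ) < P.L := B1RG242Torus.one_lt_cast_L P
  have ha' : 0 < B1RG242Torus.α P a k * (P.L : ℝ) ^ (k * P.d) :=
    mul_pos (mul_pos (B1.aSeq_pos ha hL1 hk1) (inv_pos.2 (pow_pos (P.spacing_pos k) 2))) (pow_pos P.cast_L_pos _)
  have hc' : P.eps⁻¹ ≠ 0 := inv_ne_zero P.eps_pos.ne'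
  have hΩ : IsBlockUnion k (cubeT hPd (P.L ^ k) c fun i => P.L ^ k * M i) := isBlockUnion_cubeT hPd hk rfl hfit
  have hmo : ∀ (w : Balaban1983to89.Site P 0 → ℂ) (z : Balaban1983to89.Site P 0), (mulOp h *ᵥ w) z = toC (h z) * w z :=
    fun w z => by simp only [mulOp, mulVec_diagonal]
  have hg : ∀ z : Balaban1983to89.Site P 0, ((mulOp h)ᴴ *ᵥ f) z = star (toC (h z)) * f z := fun z => by
    simp only [mulOp, diagonal_conjTranspose, mulVec_diagonal, Pi.star_apply]
  rw [gBox_gaugeAct hk0 hc' ha' h U hΩ, ← mulVec_mulVec, ← mulVec_mulVec, hmo, norm_mul, norm_toC, one_mul]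
  refine hmain P hPd hPL k hk1 hk c M hM hfit hN U T δ hInt hTree hsmall x _ F D (fun y => ?_) (fun y hy => hsupp y ?_)
  · rw [hg, norm_mul, norm_star, norm_toC, one_mul]; exact hF y
  · intro hf
    exact hy (by rw [hg, hf, mul_zero])

end Corollaries

/-! ## §6 (v1.1) The bound under the PRINTED hypothesis (7.3.1) — small plaquette variables, no gauge condition -/

section SmallPlaquette

open BIJ88DeltaLoc234Torus (mulOp gBox_gaugeAct conjTranspose_mul_mulOp)
open GaugeField (gaugeAct plaqHol)
open BIJ88NeumannPropagatorSmallPlaquetteRegion (gBox_congr supDist_corner_le_of_mem_cubeT)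
open BIJ85CentredAxialGauge (centredGauge dist1_centredGauge_le)
open BIJ85HolonomyDeviation (norm_holCK_sub_one_le)
open BIJ88Smooth43Axial (dist1_eq_norm_toC_sub_one)
open BIJ88Sect3Statements (toC_one)

/-- **THE `k`-UNIFORM OPERATOR-FORM BOUND UNDER THE PRINTED HYPOTHESIS (7.3.1) — SMALL PLAQUETTE VARIABLES — WITH NO GAUGE CONDITION**
(p31's (H1.10) binder): there are `δ₀, c₀ > 0` depending on `(d, ℓ, a)` only such that for every volume with `P.d = d + 1 ≤ 3`,
`P.L = ℓ + 1`, every `1 ≤ k ≤ m + K`, every `U(1)` field with `|u(∂p) − 1| ≤ θ` for all plaquettes of the fine torus, every fitting cube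
`□ = c·L^k + Π_i[0, L^kM_i)` (`M_i ≥ 1`) inside the ball of sup-radius `R ≥ L^kM_i` around its corner with `2R + 4 < |T|`, and every
`T ≥ dRθ` with `2(L^k−1)L^k(d+1)T² + 2((d+1)(L^k−1)T)² ≤ 1/2`: `‖(G_k(□,u)f)(x)‖ ≤ (L^kε)²·c₀e^{−δ₀D/L^k}F` for every `x` and every `f`
with `‖f‖_∞ ≤ F` vanishing on `{T(x,·) < D}`.  PROOF = [I] p. 326 *"by change of gauge u_k can be transformed in a local region Λ into a
configuration … smooth and small"*, exactly as in p34's `decay_kernel_smallPlaquette_region`: p30's centred axial gauge `h` of the ball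
(`dist1_centredGauge_le`), the field `u′ = u^h` on the bonds starting in the ball and `1` elsewhere (bondwise `T`-small everywhere, hence
`|u′(Γ^{(k)}_x) − 1| ≤ (d+1)(L^k−1)T`, p33's `norm_holCK_sub_one_le`), §5's `decay110_smallField_cube_input` for `u′` and the source `M_hf`
(same modulus and support as `f`), the locality `G_k(□,u′) = G_k(□,u^h)` (p34 `gBox_congr`) and `G_k(□,u) = M_hᴴG_k(□,u^h)M_h` (p31
`gBox_gaugeAct`). [cite: BalabanImbrieJaffe1985, (7.3.1)–(7.3.2) p.326] -/
theorem decay110_smallPlaquette_cube (d ℓ : ℕ) (hd3 : d + 1 ≤ 3) (hℓ : 1 ≤ ℓ) {a : ℝ} (ha : 0 < a) :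
    ∃ δ₀ c₀ : ℝ, 0 < δ₀ ∧ 0 < c₀ ∧ ∀ (P : Params) (hPd : P.d = d + 1), P.L = ℓ + 1 →
      ∀ k : ℕ, 1 ≤ k → k ≤ P.m + P.K → ∀ (U : GaugeField P 0 U1) (θ : ℝ), 0 ≤ θ →
        (∀ p : Balaban1983to89.Plaq P 0, ‖toC (plaqHol U p) - 1‖ ≤ θ) →
        ∀ (c M : Fin (d + 1) → ℕ) (R : ℕ), (∀ i, 1 ≤ M i) → (∀ i, c i * P.L ^ k + P.L ^ k * M i ≤ P.sitesPerDir 0) →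
          (∀ i, P.L ^ k * M i ≤ R) → 2 * R + 4 < P.sitesPerDir 0 →
        ∀ (T : ℝ), ((P.d - 1 : ℕ) : ℝ) * R * θ ≤ T →
          2 * (((P.L : ℝ) ^ k - 1) * (P.L : ℝ) ^ k) * P.d * T ^ 2 + 2 * (P.d * ((P.L : ℝ) ^ k - 1) * T) ^ 2 ≤ 1 / 2 →
          ∀ (x : Balaban1983to89.Site P 0) (f : Balaban1983to89.Site P 0 → ℂ) (F D : ℝ), (∀ y, ‖f y‖ ≤ F) →
            (∀ y, f y ≠ 0 → D ≤ B5Ineq137Torus.T P 0 x y) →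
            ‖(gBox (B1RG242Torus.α P a k * (P.L : ℝ) ^ (k * P.d)) P.eps⁻¹ U k (cubeT hPd (P.L ^ k) c fun i => P.L ^ k * M i) *ᵥ f) x‖
              ≤ P.spacing k ^ 2 * (c₀ * Real.exp (-(δ₀ * (((P.L : ℝ) ^ k)⁻¹ * D))) * F) := by
  obtain ⟨δ₀, c₀, hδ₀, hc₀, H⟩ := decay110_smallField_cube_input d ℓ hd3 hℓ ha
  refine ⟨δ₀, c₀, hδ₀, hc₀, ?_⟩
  intro P hPd hPL k hk1 hk U θ hθ hplaq c M R hM hfit hRM hR T hT hsmall x f F D hF hsupp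
  have hk0 : 0 + k ≤ P.m + P.K := by omega
  have hL1 : (1 : ℝ) < P.L := B1RG242Torus.one_lt_cast_L P
  have ha' : 0 < B1RG242Torus.α P a k * (P.L : ℝ) ^ (k * P.d) :=
    mul_pos (mul_pos (B1.aSeq_pos ha hL1 hk1) (inv_pos.2 (pow_pos (P.spacing_pos k) 2))) (pow_pos P.cast_L_pos _)
  have hc' : P.eps⁻¹ ≠ 0 := inv_ne_zero P.eps_pos.ne'
  have hN : ∀ i, P.L ^ k * M i < P.sitesPerDir 0 := fun i => by have := hRM i; omega
  have hΩ : IsBlockUnion k (cubeT hPd (P.L ^ k) c fun i => P.L ^ k * M i) := isBlockUnion_cubeT hPd hk rfl hfit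
  have hT0 : 0 ≤ T := le_trans (by positivity) hT
  -- the plaquette bound in the interface distance
  have hplaq' : ∀ p : Balaban1983to89.Plaq P 0, dist1 (plaqHol U p) ≤ θ := fun p => by
    rw [dist1_eq_norm_toC_sub_one]; exact hplaq p
  -- the centred gauge of the ball around the corner and the field cut to the ball
  set x₀ : Balaban1983to89.Site P 0 := cubePt hPd (P.L ^ k) c 0 with hx₀
  set h : GaugeTransf P 0 U1 := centredGauge U x₀ R with hh
  set U' : GaugeField P 0 U1 := fun b => if supDist x₀ b.src ≤ R then gaugeAct h U b else 1 with hU'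
  have hbond : ∀ b : PBond P 0, ‖toC (U' b) - 1‖ ≤ T := fun b => by
    by_cases hb : supDist x₀ b.src ≤ R
    · have h1 : U' b = gaugeAct h U ⟨b.src, b.dir⟩ := by simp only [hU', hb, if_true]
      have h2 := dist1_centredGauge_le U hθ hplaq' x₀ hR b.src hb b.dir
      rw [dist1_eq_norm_toC_sub_one, ← hh] at h2
      rw [h1]
      refine h2.trans (le_trans ?_ hT)
      have : (supDist x₀ b.src : ℝ) ≤ R := by exact_mod_cast hb
      exact mul_le_mul_of_nonneg_right (mul_le_mul_of_nonneg_left this (Nat.cast_nonneg _)) hθ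
    · have h1 : U' b = 1 := by simp only [hU', hb, if_false]
      rw [h1, toC_one, sub_self, norm_zero]; exact hT0
  have htree : ∀ z : Balaban1983to89.Site P 0, ‖holCK U' k z - 1‖ ≤ P.d * ((P.L : ℝ) ^ k - 1) * T := fun z =>
    norm_holCK_sub_one_le hT0 hbond k z
  -- locality and the gauge covariance: `G_k(□,u) = M_hᴴ·G_k(□,u′)·M_h`
  have hloc : gBox (B1RG242Torus.α P a k * (P.L : ℝ) ^ (k * P.d)) P.eps⁻¹ U' k (cubeT hPd (P.L ^ k) c fun i => P.L ^ k * M i) =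
      gBox (B1RG242Torus.α P a k * (P.L : ℝ) ^ (k * P.d)) P.eps⁻¹ (gaugeAct h U) k (cubeT hPd (P.L ^ k) c fun i => P.L ^ k * M i) :=
    gBox_congr hk0 _ _ fun b hb => by
      have hbs : supDist x₀ b.src ≤ R := supDist_corner_le_of_mem_cubeT hPd hfit hRM ((mem_starB _ b).1 hb).1
      simp only [hU', hbs, if_true]
  have hGU : gBox (B1RG242Torus.α P a k * (P.L : ℝ) ^ (k * P.d)) P.eps⁻¹ U k (cubeT hPd (P.L ^ k) c fun i => P.L ^ k * M i) =
      (mulOp h)ᴴ * gBox (B1RG242Torus.α P a k * (P.L : ℝ) ^ (k * P.d)) P.eps⁻¹ U' k (cubeT hPd (P.L ^ k) c fun i => P.L ^ k * M i) *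
        mulOp h := by
    rw [hloc, gBox_gaugeAct hk0 hc' ha' h U hΩ, Matrix.mul_assoc, Matrix.mul_assoc, Matrix.mul_assoc, conjTranspose_mul_mulOp,
      Matrix.mul_one, ← Matrix.mul_assoc, conjTranspose_mul_mulOp, Matrix.one_mul]
  have hmo : ∀ (w : Balaban1983to89.Site P 0 → ℂ) (z : Balaban1983to89.Site P 0), (mulOp h *ᵥ w) z = toC (h z) * w z :=
    fun w z => by simp only [mulOp, mulVec_diagonal]
  have hmoH : ∀ (w : Balaban1983to89.Site P 0 → ℂ) (z : Balaban1983to89.Site P 0), ((mulOp h)ᴴ *ᵥ w) z = star (toC (h z)) * w z :=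
    fun w z => by simp only [mulOp, diagonal_conjTranspose, mulVec_diagonal, Pi.star_apply]
  rw [hGU, ← mulVec_mulVec, ← mulVec_mulVec, hmoH, norm_mul, norm_star, norm_toC, one_mul]
  -- §5 for the cut field `u′` and the source `M_hf`
  refine H P hPd hPL k hk1 hk c M hM hfit hN U' T (P.d * ((P.L : ℝ) ^ k - 1) * T) (fun b _ _ => hbond b) (fun z _ => htree z)
    hsmall x _ F D (fun y => ?_) (fun y hy => hsupp y ?_)
  · rw [hmo, norm_mul, norm_toC, one_mul]; exact hF y
  · intro hf
    exact hy (by rw [hmo, hf, mul_zero])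

end SmallPlaquette

/-! ## §7 (v1.2) The bound under (7.3.1) with a threshold UNIFORM in the cube and the volume: the blockwise centred gauge -/

section Uniform

open BIJ88DeltaLoc234Torus (mulOp gBox_gaugeAct conjTranspose_mul_mulOp)
open GaugeField (gaugeAct plaqHol)
open BIJ88NeumannPropagatorSmallPlaquetteRegion (holCK_congr)
open BIJ85CentredAxialGauge (centredGauge dist1_centredGauge_le)
open BIJ85HolonomyDeviation (norm_holCK_sub_one_le)
open BIJ88Smooth43Axial (dist1_eq_norm_toC_sub_one)
open BIJ88Sect3Statements (toC_one)
open BIJ85ScalarPropagatorDecay (supDist_le_of_blkIter_eq)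

/-- **THE `k`-UNIFORM OPERATOR-FORM BOUND UNDER THE PRINTED HYPOTHESIS (7.3.1) WITH A THRESHOLD DEPENDING ON `(d, L^k)` ONLY** — uniform in
the cube (its size `M` and position `c`), in the volume and in the field: there are `δ₀, c₀ > 0` depending on `(d, ℓ, a)` only such that for
every volume with `P.d = d + 1 ≤ 3`, `P.L = ℓ + 1` and more than two `k`-blocks per direction (`2(L^k − 1) + 4 < |T|`), every
`1 ≤ k ≤ m + K`, every `U(1)` field with `|u(∂p) − 1| ≤ θ` for all plaquettes, every `T ≥ d(L^k − 1)θ` (`d = P.d − 1`) with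
`2(L^k−1)L^k(d+1)T² + 2((d+1)(L^k−1)T)² ≤ 1/2`, every fitting no-wrap cube `□ = c·L^k + Π_i[0, L^kM_i)` (`M_i ≥ 1`), every `x` and every `f`
with `‖f‖_∞ ≤ F` vanishing on `{T(x,·) < D}`: `‖(G_k(□,u)f)(x)‖ ≤ (L^kε)²·c₀e^{−δ₀D/L^k}F`.  PROOF: the engine's hypotheses (§4) are
BLOCK-LOCAL, so the change of gauge of [I] p. 326 can be made block by block — `h(z) =` p30's centred axial gauge of the `k`-block of `z`
(centre its corner, radius `L^k − 1`; `dist1_centredGauge_le`): on every bond with both ends in one `k`-block `u^h` is the block's own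
axially gauged field, `|u^h(b) − 1| ≤ d(L^k − 1)θ ≤ T`; the composite transport `u^h(Γ^{(k)}_y)` reads only such bonds (p34's locality
`holCK_congr`), so `|u^h(Γ^{(k)}_y) − 1| ≤ (d+1)(L^k − 1)T` (p33 `norm_holCK_sub_one_le` for the field cut to the intra-block bonds); §5's
`decay110_smallField_cube_input` for `u^h` and the source `M_hf`, and `G_k(□,u) = M_hᴴG_k(□,u^h)M_h` (p31 `gBox_gaugeAct`).  Compared with
§6 the radius of the gauge ball is the block size, not the cube size. [cite: BalabanImbrieJaffe1985, (7.3.1)–(7.3.2) p.326] -/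
theorem decay110_smallPlaquette_cube_uniform (d ℓ : ℕ) (hd3 : d + 1 ≤ 3) (hℓ : 1 ≤ ℓ) {a : ℝ} (ha : 0 < a) :
    ∃ δ₀ c₀ : ℝ, 0 < δ₀ ∧ 0 < c₀ ∧ ∀ (P : Params) (hPd : P.d = d + 1), P.L = ℓ + 1 →
      ∀ k : ℕ, 1 ≤ k → k ≤ P.m + P.K → 2 * (P.L ^ k - 1) + 4 < P.sitesPerDir 0 →
      ∀ (U : GaugeField P 0 U1) (θ : ℝ), 0 ≤ θ → (∀ p : Balaban1983to89.Plaq P 0, ‖toC (plaqHol U p) - 1‖ ≤ θ) →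
        ∀ (T : ℝ), ((P.d - 1 : ℕ) : ℝ) * ((P.L : ℝ) ^ k - 1) * θ ≤ T →
          2 * (((P.L : ℝ) ^ k - 1) * (P.L : ℝ) ^ k) * P.d * T ^ 2 + 2 * (P.d * ((P.L : ℝ) ^ k - 1) * T) ^ 2 ≤ 1 / 2 →
        ∀ (c M : Fin (d + 1) → ℕ), (∀ i, 1 ≤ M i) → (∀ i, c i * P.L ^ k + P.L ^ k * M i ≤ P.sitesPerDir 0) →
          (∀ i, P.L ^ k * M i < P.sitesPerDir 0) →
          ∀ (x : Balaban1983to89.Site P 0) (f : Balaban1983to89.Site P 0 → ℂ) (F D : ℝ), (∀ y, ‖f y‖ ≤ F) →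
            (∀ y, f y ≠ 0 → D ≤ B5Ineq137Torus.T P 0 x y) →
            ‖(gBox (B1RG242Torus.α P a k * (P.L : ℝ) ^ (k * P.d)) P.eps⁻¹ U k (cubeT hPd (P.L ^ k) c fun i => P.L ^ k * M i) *ᵥ f) x‖
              ≤ P.spacing k ^ 2 * (c₀ * Real.exp (-(δ₀ * (((P.L : ℝ) ^ k)⁻¹ * D))) * F) := by
  obtain ⟨δ₀, c₀, hδ₀, hc₀, H⟩ := decay110_smallField_cube_input d ℓ hd3 hℓ ha
  refine ⟨δ₀, c₀, hδ₀, hc₀, ?_⟩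
  intro P hPd hPL k hk1 hk hR U θ hθ hplaq T hT hsmall c M hM hfit hN x f F D hF hsupp
  have hk0 : 0 + k ≤ P.m + P.K := by omega
  have hL1 : (1 : ℝ) < P.L := B1RG242Torus.one_lt_cast_L P
  have ha' : 0 < B1RG242Torus.α P a k * (P.L : ℝ) ^ (k * P.d) :=
    mul_pos (mul_pos (B1.aSeq_pos ha hL1 hk1) (inv_pos.2 (pow_pos (P.spacing_pos k) 2))) (pow_pos P.cast_L_pos _)
  have hc' : P.eps⁻¹ ≠ 0 := inv_ne_zero P.eps_pos.ne'
  have hΩ : IsBlockUnion k (cubeT hPd (P.L ^ k) c fun i => P.L ^ k * M i) := isBlockUnion_cubeT hPd hk rfl hfit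
  have hT0 : 0 ≤ T := by
    refine le_trans (mul_nonneg (mul_nonneg (Nat.cast_nonneg _) ?_) hθ) hT
    have : (1 : ℝ) ≤ (P.L : ℝ) ^ k := one_le_pow₀ hL1.le
    linarith
  have hplaq' : ∀ p : Balaban1983to89.Plaq P 0, dist1 (plaqHol U p) ≤ θ := fun p => by
    rw [dist1_eq_norm_toC_sub_one]; exact hplaq p
  -- the blockwise centred gauge: on the `k`-block of `z`, p30's centred axial gauge of that block (centre its corner, radius `L^k − 1`)
  set R : ℕ := P.L ^ k - 1 with hRdef
  set h : GaugeTransf P 0 U1 := fun z => centredGauge U (cornerIter k (blkIter k z)) R z with hh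
  have hcast : ((R : ℕ) : ℝ) = (P.L : ℝ) ^ k - 1 := by
    rw [hRdef, Nat.cast_sub (Nat.one_le_pow _ _ P.L_pos), Nat.cast_pow, Nat.cast_one]
  -- every bond with both ends in one `k`-block is `T`-small for `u^h`
  have hbond : ∀ b : PBond P 0, blkIter k b.src = blkIter k b.tgt → ‖toC (gaugeAct h U b) - 1‖ ≤ T := by
    intro b hb
    set x₀ : Balaban1983to89.Site P 0 := cornerIter k (blkIter k b.src) with hx₀
    have e : gaugeAct h U b = gaugeAct (centredGauge U x₀ R) U ⟨b.src, b.dir⟩ := by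
      show h b.src * U b * (h b.tgt)⁻¹ = centredGauge U x₀ R b.src * U b * (centredGauge U x₀ R b.tgt)⁻¹
      simp only [hh, hx₀, hb]
    have hz : supDist x₀ b.src ≤ R :=
      supDist_le_of_blkIter_eq hk0 (by rw [hx₀, blkIter_cornerIter k hk0])
    have h2 := dist1_centredGauge_le U hθ hplaq' x₀ hR b.src hz b.dir
    rw [dist1_eq_norm_toC_sub_one] at h2
    rw [e]
    refine h2.trans (le_trans ?_ hT)
    have hz' : (supDist x₀ b.src : ℝ) ≤ (P.L : ℝ) ^ k - 1 := by rw [← hcast]; exact_mod_cast hz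
    exact mul_le_mul_of_nonneg_right (mul_le_mul_of_nonneg_left hz' (Nat.cast_nonneg _)) hθ
  -- the composite transports of `u^h` read only intra-block bonds
  have htree : ∀ y : Balaban1983to89.Site P 0, ‖holCK (gaugeAct h U) k y - 1‖ ≤ P.d * ((P.L : ℝ) ^ k - 1) * T := by
    intro y
    set V : GaugeField P 0 U1 := fun b => if blkIter k b.src = blkIter k b.tgt then gaugeAct h U b else 1 with hV
    have hVb : ∀ b : PBond P 0, ‖toC (V b) - 1‖ ≤ T := fun b => by
      by_cases hb : blkIter k b.src = blkIter k b.tgt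
      · have h1 : V b = gaugeAct h U b := by simp only [hV]; exact if_pos hb
        rw [h1]; exact hbond b hb
      · have h1 : V b = 1 := by simp only [hV]; exact if_neg hb
        rw [h1, toC_one, sub_self, norm_zero]; exact hT0
    have hcongr : holCK (gaugeAct h U) k y = holCK V k y :=
      holCK_congr k hk0 y fun b hb1 hb2 => by
        have h1 : V b = gaugeAct h U b := by simp only [hV]; exact if_pos (hb1.trans hb2.symm)
        rw [h1]
    rw [hcongr]
    exact norm_holCK_sub_one_le hT0 hVb k y
  -- `G_k(□,u) = M_hᴴ·G_k(□,u^h)·M_h`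
  have hGU : gBox (B1RG242Torus.α P a k * (P.L : ℝ) ^ (k * P.d)) P.eps⁻¹ U k (cubeT hPd (P.L ^ k) c fun i => P.L ^ k * M i) =
      (mulOp h)ᴴ * gBox (B1RG242Torus.α P a k * (P.L : ℝ) ^ (k * P.d)) P.eps⁻¹ (gaugeAct h U) k
        (cubeT hPd (P.L ^ k) c fun i => P.L ^ k * M i) * mulOp h := by
    rw [gBox_gaugeAct hk0 hc' ha' h U hΩ, Matrix.mul_assoc, Matrix.mul_assoc, Matrix.mul_assoc, conjTranspose_mul_mulOp,
      Matrix.mul_one, ← Matrix.mul_assoc, conjTranspose_mul_mulOp, Matrix.one_mul]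
  have hmo : ∀ (w : Balaban1983to89.Site P 0 → ℂ) (z : Balaban1983to89.Site P 0), (mulOp h *ᵥ w) z = toC (h z) * w z :=
    fun w z => by simp only [mulOp, mulVec_diagonal]
  have hmoH : ∀ (w : Balaban1983to89.Site P 0 → ℂ) (z : Balaban1983to89.Site P 0), ((mulOp h)ᴴ *ᵥ w) z = star (toC (h z)) * w z :=
    fun w z => by simp only [mulOp, diagonal_conjTranspose, mulVec_diagonal, Pi.star_apply]
  rw [hGU, ← mulVec_mulVec, ← mulVec_mulVec, hmoH, norm_mul, norm_star, norm_toC, one_mul]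
  refine H P hPd hPL k hk1 hk c M hM hfit hN (gaugeAct h U) T (P.d * ((P.L : ℝ) ^ k - 1) * T) (fun b _ hb => hbond b hb)
    (fun z _ => htree z) hsmall x _ F D (fun y => ?_) (fun y hy => hsupp y ?_)
  · rw [hmo, norm_mul, norm_toC, one_mul]; exact hF y
  · intro hf
    exact hy (by rw [hmo, hf, mul_zero])

end Uniform

end

end Literature.MathematicalPhysics.QuantumFieldTheory.BalabanImbrieJaffe1984to88.BIJ88NeumannPropagatorSmallFieldSupDecay

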